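import Summits.ResolutionOfSingularities.ResolutionOfSingularities.Theses.AbhyankarShadows
import Summits.ResolutionOfSingularities.ResolutionOfSingularities.Theses.IndSmooth
import Summits.ResolutionOfSingularities.ResolutionOfSingularities.Theorems.AbhyankarShadowsRationalSuffices
import Literature.AlgebraicGeometry.Resolution.ResolutionLU
import Literature.AlgebraicGeometry.Resolution.NonReducedNoResolution
import Literature.AlgebraicGeometry.Resolution.AbsoluteIntegralClosureNoResolution
import Literature.AlgebraicGeometry.Resolution.AffineModelObstructions
import Literature.AlgebraicGeometry.Resolution.AffineDomainDimension
import Literature.AlgebraicGeometry.Resolution.ProperModelsPatchingOfResolution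
import Literature.AlgebraicGeometry.Resolution.LocalUniformizationClosedPoints
import Literature.AlgebraicGeometry.Resolution.LocalUniformizationAbhyankarPlaces
import Summits.ResolutionOfSingularities.ResolutionOfSingularities.Theorems.ValuativePatchingRelRegularBlowupLine
import Summits.ResolutionOfSingularities.ResolutionOfSingularities.Theorems.RegularBlowupsDesingularization
import Summits.ResolutionOfSingularities.ResolutionOfSingularities.Theorems.ValuativePatchingRelAxiomFourEquivalence
import Summits.ResolutionOfSingularities.ResolutionOfSingularities.Theorems.FrobeniusLadderFRationalResolutionQuadricConeResolution
import Literature.AlgebraicGeometry.Resolution.ZariskiPatchingAllDimensions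
import Literature.AlgebraicGeometry.Resolution.ProjectiveBirationalBlowupProofs
import Literature.AlgebraicGeometry.Resolution.ComponentGluing
import Literature.AlgebraicGeometry.Resolution.ProjectiveSpaceRegular
import Summits.ResolutionOfSingularities.ResolutionOfSingularities.Theorems.ValuativePatchingRelFormatUpgrade
import Summits.ResolutionOfSingularities.ResolutionOfSingularities.Theorems.ValuativePatchingRelDimThreeFormat
import HarnessLib

/-!
# Disproof of `PatchingPerfect` (stmt-ResolutionOfSingularities-16089) — standing disprover's work file

Crux (rank 4 of routes `AbhyankarShadows` and `IndSmooth`, verbatim the same term,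
`indSmooth_patchingPerfect_iff`):

`PatchingPerfect : ∀ p prime, ∀ k perfect of char p, RelLUAt k → ResolvesAt k` — relative Zariski
local uniformization over ONE perfect field `k` (every finitely generated `R ⊆ O` of a finitely
generated `K/k`, `O ∋ k` a valuation ring, is dominated by a finitely generated `A ⊆ O`,
`Frac A = K`, regular at the centre of `O`) implies weak resolution (`Scheme.HasResolution`) of
every reduced separated `k`-scheme of finite type.

## Findings (cycle 1, 2026-08-17)

* §0 `patchingPerfect_iff`, `indSmooth_patchingPerfect_iff`, `lurelPerfect_iff` — the crux
  unfolded fieldwise; the two route copies are one term; `IndSmooth.LurelPerfect` is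
  `∀ p k perfect, RelLUAt k`.
* §1 WHY IT RESISTS (all proved): `relLUAt_of_resolvesAt` (resolution over `k` ⇒ relative LU over
  `k`, for EVERY field `k`), hence `patchingPerfect_iff_relLU_iff_resolves : PatchingPerfect ↔
  ∀ p k perfect, (RelLUAt k ↔ ResolvesAt k)` and `not_patchingPerfect_iff : ¬ PatchingPerfect ↔
  ∃ p k perfect, RelLUAt k ∧ ¬ ResolvesAt k`: a kill must PROVE local uniformization over some
  perfect field in EVERY transcendence degree (open from 4) AND refute weak resolution over that
  same field. `patchingPerfect_of_resolution_over_perfect`, `patchingPerfect_of_summit`: the crux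
  is a slice of the summit. EXACT OPEN CONTENT, fieldwise (proved both ways over the tree's
  per-field Zariski–Piltant engine): `patchingPerfect_iff_relLU_imp_properTwoModelPatching :
  PatchingPerfect ↔ ∀ p k perfect, RelLUAt k → ProperTwoModelPatchingAt k` (Piltant 2013
  Prop. 5.1, `P = P_reg`, for proper models of `K/k`; open in trdeg `≥ 4`).
* §2 LOAD-BEARING ANALYSIS OF THE ANTECEDENT `RelLUAt k` (each clause dropped, as theorems):
  (A1) `k ⊆ O` — redundant (`relLUNoConstAt_iff`); (A2) `IsFractionRing A K` — redundant
  (`relLUNoFracAt_iff`); (A3) regularity at the centre — THE content: dropped, the antecedent is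
  a theorem (`relLUNoRegAt_holds`) and the crux collapses to resolution over all perfect fields
  (`patchingPerfectWithoutReg_iff`), i.e. to the antecedent of `DescentPerfectToAll`
  (stmt-0549) — no cheaper than the summit over perfect fields; (A4) `R.FG` — a TRAP: dropped,
  the antecedent is FALSE over every field (`not_relLUNoRFGAt`, witness `K = k(X)`, `O = K`,
  `R = K`, Zariski's lemma) and the crux is vacuously true (`patchingPerfectWithoutRFG_holds`);
  (A5) `(⊤ : IntermediateField k K).FG` — a TRAP: false over EVERY field (`not_relLUNoKFGAt`,
  witness `K = k(X₀, X₁, …)` of transcendence degree `ℵ₀`, `O = K`, `R = ⊥`), vacuous crux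
  (`patchingPerfectWithoutKFG_holds`); (A6) `PerfectField k` — a RESTRICTION
  only: `patchingPerfect_of_patchingAllFields`; it is used by NO step of the tree's engine
  (`resolvesAt_of_properTwoModelPatchingAt_of_relLUAt` is stated for every field); what it DOES
  buy is on the antecedent's side: over a perfect `k` relative LU is FREE at Abhyankar places
  (Knaf–Kuhlmann 2005, tree `relLU_at_abhyankarPlace_of_perfectField`) and at valuation rings
  that are not closed points of the Zariski–Riemann space (tree `relLU_of_relLU_zeroDim`), so
  `relLUAt_iff_hard : RelLUAt k ↔ RelLUHardAt k` — the antecedent's content sits exactly at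
  ZERO-DIMENSIONAL NON-ABHYANKAR valuation rings (positive defect / rank-deficient places). For
  route `AbhyankarShadows` this says its cruxes K1/K2 are only ever needed at non-Abhyankar
  rational `O` — Teissier's own scope. (A6″) Route `AbhyankarShadows` OVER-ASKS: its `closes`
  consumes only the algebraically closed slice `PatchingAlgClosed` (`summit_of_patchingAlgClosed`
  re-derives the summit from K1, K2, `PatchingAlgClosed`, 0550, 0549 and the landed
  `rationalSuffices_proof`) — a planner may restate; neither slice is refutable.
* §3 CONSEQUENT MUTATIONS (natural strengthenings refuted, unconditionally):
  (C1) `IsReduced` dropped — the consequent is FALSE over every field (`not_resolvesNoReducedAt`,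
  `Spec k[ε]`), so `patchingPerfectWithoutReduced_iff : … ↔ ∀ p k perfect, ¬ RelLUAt k`, and that
  variant is INCONSISTENT with the rest of either route
  (`patchingPerfectWithoutReduced_refutes_lurelPerfect`,
  `patchingPerfectWithoutReduced_inconsistent_shadows`);
  (C2) `LocallyOfFiniteType` dropped — FALSE over every field (`not_resolvesNoFTAt`,
  `Spec k[X]⁺`, the absolute integral closure of the affine line: root-closed, Noetherian only at
  the generic point; the tree's `𝔽_p` witness generalised to any `k`), so
  `patchingPerfectWithoutFT_iff : … ↔ ∀ p k perfect, ¬ RelLUAt k`, inconsistent with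
  `LurelPerfect` and with K1 ∧ K2 ∧ RationalSuffices likewise;
  (C3) `QuasiCompact` / `IsSeparated` dropped — not refutable and not provably harmless without
  functorial resolution (gluing over infinite covers / non-separated pushouts); not formalised.
* §4 (cycle 1 note, superseded by §4–§5 below) — no line picked yet (`PICKED.md` absent); the registered birth skeleton
  `Lines/birth.lean` has stubs `stub_principalizationPerfect` (Axiom 4 over perfect `k`),
  `stub_badPointsPerfect` (ExcAdm ⇒ SingAdm over perfect `k`), `stub_liu2002` (theorem in print).
  They are the per-field slices of the sibling crux `PatchingRel`'s v3.8 stubs, whose typing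
  survived four drefute generations (`Cruxes/PatchingRel/DrefuteStubsSurvived.md`,
  `DrefuteG4v3Report.md`); slicing to one perfect field introduces no new junk instance (the
  predicates quantify over the same schemes; `PerfectField k` is never consumed). Nothing to
  kill cheaply; see §4 docstrings for the two typing points a lead should keep
  (`IsBlowup π ⊤` must be inhabited by isomorphisms for `SingAdmissibleAt` at regular `V` — it
  is, tree `isBlowup_id_top`, cf. the sibling's `Theorems/PatchingRel/Negative/` junk guards;
  `I.support` vs the non-invertible locus in `PrincipalizationAt`).
* §4–§5 (cycle 2 = cdisprove g2, 2026-08-17) TARGETS = the registered birth line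
  (`Lines/birth.lean`, stubs `stub_principalizationPerfect`, `stub_badPointsPerfect`,
  `stub_liu2002`; predicates copied verbatim, no sorried file imported): stub 3 is the tree theorem
  `Liu2002Thm8124Projective_holds` (`stub_liu2002_holds`); stub 1 ⟺ exceptional-admissible
  desingularization fieldwise (`principalizationAt_iff_excAdmissibleAt`); EXACT RESIDUAL
  `stub 1 ∧ stub 2 ↔ ∀ p k perfect, SingAdmissibleAt k` (`stubs_iff_singAdmissible_perfect`) = the
  per-field slice of `PatchingRel`'s dead-line atom SAND⁺ᵇ on `Bl_I U`; SLACK: the quasi-projective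
  atom over perfect fields alone gives the crux (`patchingPerfect_of_singAdmissibleQProj_perfect`,
  `patchingPerfect_of_two_stubs` without stub 3); clause-by-clause load-bearing analysis of both
  open stubs with witnesses (quadric cone `yz + x² = 0`, the empty blowing up of `⊥`):
  `not_principalizationNoRegBaseAt`, `principalizationNoCartierAt_trivial`,
  `principalizationNoRegSourceAt_holds`, `principalizationAt_bot_instance`,
  `not_singAdmissibleNoNeBotAt`, `not_excAdmissibleNoNeBotAt`, `not_excAdmissibleNoRegBaseAt`,
  `singAdmissibleNoRegBaseAt_iff_blowupStrongResAt`, `resolvesAt_of_blowupStrongResAt`; §4.5 FORMAT: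
  `birthStubsAt_iff_principalization_and_strongRes` (the blow-up format of stub 2 is free modulo
  stub 1). Verdicts for the lead in §5. No stub is false as typed; no kill of the crux (unchanged: §1).
* WHY NO KILL IS AVAILABLE (summary): every junk instance of the antecedent (`K = k`, `O = K`,
  `R = ⊥`, trdeg `≤ 1`, Abhyankar `O`, non-closed `O`) is TRUE, and the consequent is the summit
  slice at a perfect field, whose junk instances (`X = ∅`, `X` regular) are TRUE
  (`Scheme.IsRegular.hasResolution`); the barrier `DimensionFourFrontier` is honoured (open
  content = two-model patching in trdeg `≥ 4`). Negatives index: `DefectlessFrames_refuted`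
  only — unrelated.
-/

noncomputable section

-- single-problem summit: the doubled namespace component `ResolutionOfSingularities` is forced
set_option linter.dupNamespace false

open CategoryTheory CategoryTheory.Limits AlgebraicGeometry TopologicalSpace
open Literature.AlgebraicGeometry.Resolution Literature.AlgebraicGeometry.Motives
open Summit.ResolutionOfSingularities.ResolutionOfSingularities.Theorems
open Summit.ResolutionOfSingularities.ResolutionOfSingularities.Theses
open Summit.ResolutionOfSingularities.ResolutionOfSingularities.Theses.AbhyankarShadows
  (PatchingPerfect SemivaluationShadows ShadowsUniformize RationalSuffices DescentPerfectToAll)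

namespace Summit.ResolutionOfSingularities.ResolutionOfSingularities.Cruxes.PatchingPerfect.Disproof

/-! ## §0 The crux, fieldwise -/

/-- **Relative local uniformization over `k`** — the ANTECEDENT of the crux at `(p, k)`,
verbatim. [cite: ZariskiSamuel1960, Ch. VI §17 (shape)] -/
def RelLUAt (k : Type) [Field k] : Prop :=
  ∀ (K : Type) [Field K] [Algebra k K], (⊤ : IntermediateField k K).FG →
    ∀ O : ValuationSubring K, (∀ c : k, algebraMap k K c ∈ O) → ∀ R : Subalgebra k K, R.FG →
      R.toSubring ≤ O.toSubring → ∃ (A : Subalgebra k K) (h : A.toSubring ≤ O.toSubring),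
        R ≤ A ∧ A.FG ∧ IsFractionRing A K ∧ IsRegularLocalRing (Localization.AtPrime
          (Ideal.comap (Subring.inclusion h) (IsLocalRing.maximalIdeal O)))

/-- **Weak resolution of every reduced separated `k`-scheme of finite type** — the CONSEQUENT
of the crux at `(p, k)`, verbatim. [folklore] -/
def ResolvesAt (k : Type) [Field k] : Prop :=
  ∀ (X : Scheme.{0}) (f : X ⟶ Spec (.of k)), IsSeparated f → LocallyOfFiniteType f →
    QuasiCompact f → IsReduced X → Scheme.HasResolution X

/-- The crux, unfolded (definitional). [folklore] -/
theorem patchingPerfect_iff :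
    PatchingPerfect ↔ ∀ p : ℕ, p.Prime → ∀ (k : Type) [Field k] [CharP k p] [PerfectField k],
      RelLUAt k → ResolvesAt k :=
  Iff.rfl

/-- The two route copies of the crux are one term (definitional). [folklore] -/
theorem indSmooth_patchingPerfect_iff : IndSmooth.PatchingPerfect ↔ PatchingPerfect :=
  Iff.rfl

/-- Route `IndSmooth`'s target `LurelPerfect` (stmt-16086) is `RelLUAt` over all perfect fields
of all prime characteristics (binder shuffle only). [folklore] -/
theorem lurelPerfect_iff :
    IndSmooth.LurelPerfect ↔
      ∀ p : ℕ, p.Prime → ∀ (k : Type) [Field k] [CharP k p] [PerfectField k], RelLUAt k :=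
  ⟨fun h p hp k _ _ _ K _ _ => h p hp k K, fun h p hp k K _ _ _ _ _ => h p hp k K⟩

/-! ## §1 Why it resists -/

/-- **Resolution over `k` implies relative local uniformization over `k`** — for EVERY field `k`
(no characteristic, no perfectness): enlarge `R` by an affine model of `O`, resolve `Spec` of it,
read off a regular affine model at the centre (tree `exists_affineModel_regular_of_hasResolution`;
Zariski 1940 read backwards). So the converse of the crux's implication is a theorem, fieldwise.
[folklore] -/
theorem relLUAt_of_resolvesAt (k : Type) [Field k] (h : ResolvesAt k) : RelLUAt k := by
  intro K _ _ hKfg O hO R hRfg hRO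
  obtain ⟨A₀, hA₀O, hA₀fg, hA₀fr⟩ := exists_affineModel k K hKfg O hO
  have hR'O : (R ⊔ A₀).toSubring ≤ O.toSubring := by
    let Oalg : Subalgebra k K := { O.toSubring with algebraMap_mem' := hO }
    change R ⊔ A₀ ≤ Oalg
    exact sup_le (fun x hx => hRO hx) (fun x hx => hA₀O hx)
  have hR'fr : IsFractionRing ↥(R ⊔ A₀) K := isFractionRing_of_le le_sup_right hA₀fr
  have hR'fg : (R ⊔ A₀).FG := hRfg.sup hA₀fg
  haveI : Algebra.FiniteType k ↥(R ⊔ A₀) := (R ⊔ A₀).fg_iff_finiteType.mp hR'fg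
  let f : Spec (.of ↥(R ⊔ A₀)) ⟶ Spec (.of k) :=
    Spec.map (CommRingCat.ofHom (algebraMap k ↥(R ⊔ A₀)))
  haveI : LocallyOfFiniteType f :=
    (HasRingHomProperty.Spec_iff (P := @LocallyOfFiniteType)).mpr
      (RingHom.finiteType_algebraMap.mpr ‹_›)
  have hres : Scheme.HasResolution (Spec (.of ↥(R ⊔ A₀))) :=
    h _ f inferInstance inferInstance inferInstance inferInstance
  obtain ⟨A, hA, hle, hAfg, hreg⟩ :=
    exists_affineModel_regular_of_hasResolution O (R ⊔ A₀) hR'O hR'fg hR'fr hres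
  exact ⟨A, hA, le_sup_left.trans hle, hAfg, isFractionRing_of_le hle hR'fr, hreg⟩

/-- **The crux says LU and resolution are EQUIVALENT over every perfect field** (the converse
being `relLUAt_of_resolvesAt`). [folklore] -/
theorem patchingPerfect_iff_relLU_iff_resolves :
    PatchingPerfect ↔ ∀ p : ℕ, p.Prime → ∀ (k : Type) [Field k] [CharP k p] [PerfectField k],
      (RelLUAt k ↔ ResolvesAt k) :=
  ⟨fun h p hp k _ _ _ => ⟨h p hp k, relLUAt_of_resolvesAt k⟩, fun h p hp k _ _ _ => (h p hp k).1⟩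

/-- **What a refutation must exhibit**: a prime `p` and a perfect field `k` of characteristic `p`
over which relative LU HOLDS (for every finitely generated `K/k`, every trdeg) while weak
resolution FAILS. Neither half is available: LU is open from trdeg `4`, and a failure of
resolution over a perfect field refutes the summit. [folklore] -/
theorem not_patchingPerfect_iff :
    ¬ PatchingPerfect ↔ ∃ (p : ℕ) (_ : p.Prime) (k : Type) (_ : Field k) (_ : CharP k p)
      (_ : PerfectField k), RelLUAt k ∧ ¬ ResolvesAt k := by
  constructor
  · intro h
    by_contra hne
    apply h
    intro p hp k _ _ _ hLU
    by_contra hres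
    exact hne ⟨p, hp, k, inferInstance, inferInstance, inferInstance, hLU, hres⟩
  · rintro ⟨p, hp, k, hk, hc, hperf, hLU, hres⟩ h
    exact hres (h p hp k hLU)

/-- The crux follows from weak resolution over perfect fields (the antecedent of
`DescentPerfectToAll`, stmt-0549) — it is a slice of the summit, so it cannot be refuted without
refuting resolution over some perfect field. [folklore] -/
theorem patchingPerfect_of_resolution_over_perfect
    (h : ∀ p : ℕ, p.Prime → ∀ (k : Type) [Field k] [CharP k p] [PerfectField k], ResolvesAt k) :
    PatchingPerfect :=
  fun p hp k _ _ _ _ => h p hp k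

/-- The crux follows from the summit. [folklore] -/
theorem patchingPerfect_of_summit (h : _root_.ResolutionOfSingularities) : PatchingPerfect :=
  fun p hp k _ _ _ _ X f hs hl hq hr => h p hp k X f hs hl hq hr

/-- **Two-model patching of proper models of `K/k` over the field `k`** (Piltant 2013, Prop. 5.1
with `P = P_reg`, sliced at `k`): any two proper models of a `K/k` essentially of finite type are
dominated by a third through `RegLe` morphisms (`φ⁻¹(Reg M) ⊆ Reg N`). OPEN in transcendence
degree `≥ 4`. [cite: Piltant2013, Prop. 5.1 (P = P_reg) and p. 2] -/
def ProperTwoModelPatchingAt (k : Type) [Field k] : Prop :=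
  ∀ (K : Type) [Field K] [Algebra k K] [Algebra.EssFiniteType k K], ∀ M₁ M₂ : ProperModel k K,
    ∃ (N : ProperModel k K) (φ₁ : N.Hom M₁) (φ₂ : N.Hom M₂), φ₁.RegLe ∧ φ₂.RegLe

/-- **Resolution over `k` gives two-model patching over `k`** (resolve the join; a regular model
is `RegLe` over anything) — fieldwise form of the tree's `twoModelPatching_of_resolutionInChar`.
[folklore] -/
theorem properTwoModelPatchingAt_of_resolvesAt (k : Type) [Field k] (h : ResolvesAt k) :
    ProperTwoModelPatchingAt k := by
  intro K _ _ _ M₁ M₂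
  obtain ⟨N, φ, hN⟩ := (ProperModel.join M₁ M₂).exists_hom_isRegular_of_hasResolution
    (h _ (ProperModel.join M₁ M₂).π inferInstance inferInstance inferInstance inferInstance)
  exact ⟨N, φ.comp (ProperModel.joinFst M₁ M₂), φ.comp (ProperModel.joinSnd M₁ M₂),
    fun y _ => hN y, fun y _ => hN y⟩

/-- **The tree's Zariski–Piltant engine, at one field**: two-model patching of proper models over
`k` and relative LU over `k` give weak resolution over `k` in every dimension (the body of the
tree's `resolutionInChar_of_properTwoModelPatching_of_relLU`, which uses its hypotheses at the one
field only; NO perfectness, NO characteristic). [cite: Piltant2013, Prop. 5.1 and Cor. 5.7] -/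
theorem resolvesAt_of_properTwoModelPatchingAt_of_relLUAt (k : Type) [Field k]
    (hZ : ProperTwoModelPatchingAt k) (hLU : RelLUAt k) : ResolvesAt k := by
  intro X f hs hl hq hr
  haveI : QuasiCompact f := hq
  haveI : LocallyOfFiniteType f := hl
  haveI : CompactSpace X := QuasiCompact.compactSpace_of_compactSpace f
  obtain ⟨d, hd⟩ := exists_topologicalKrullDim_le_of_locallyOfFiniteType f
  have hLU' : ∀ (K : Type) [Field K] [Algebra k K] (O : ValuationSubring K) (R : Subalgebra k K),
      R.FG → IsFractionRing R K → R.toSubring ≤ O.toSubring →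
        ∃ (A : Subalgebra k K) (h : A.toSubring ≤ O.toSubring), R ≤ A ∧ A.FG ∧
          IsRegularLocalRing (Localization.AtPrime
            (Ideal.comap (Subring.inclusion h) (IsLocalRing.maximalIdeal O))) := by
    intro K _ _ O R hRfg hRfr hRO
    haveI : Algebra.FiniteType k R := R.fg_iff_finiteType.mp hRfg
    haveI : Algebra.EssFiniteType R K :=
      Algebra.EssFiniteType.of_isLocalization K (nonZeroDivisors R)
    have hKfg : (⊤ : IntermediateField k K).FG :=
      IntermediateField.fg_top_iff.mpr (Algebra.EssFiniteType.comp k R K)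
    obtain ⟨A, h, hle, hAfg, -, hreg⟩ :=
      hLU K hKfg O (fun c => hRO (R.algebraMap_mem c)) R hRfg hRO
    exact ⟨A, h, hle, hAfg, hreg⟩
  exact resolutionOverUpToDim_of_properPatching_of_relLU hZ hLU' d X f hs hl hq hr hd

/-- **EXACT OPEN CONTENT, fieldwise**: the crux is equivalent to "relative LU over a perfect `k`
implies two-model patching of proper models over `k`" (Piltant 2013 Prop. 5.1, `P = P_reg`;
open in trdeg `≥ 4`) — Zariski's reduction loses nothing, and perfectness enters neither
direction. [cite: Piltant2013, Prop. 5.1 and p. 2] -/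
theorem patchingPerfect_iff_relLU_imp_properTwoModelPatching :
    PatchingPerfect ↔ ∀ p : ℕ, p.Prime → ∀ (k : Type) [Field k] [CharP k p] [PerfectField k],
      RelLUAt k → ProperTwoModelPatchingAt k :=
  ⟨fun h p hp k _ _ _ hLU => properTwoModelPatchingAt_of_resolvesAt k (h p hp k hLU),
    fun h p hp k _ _ _ hLU => resolvesAt_of_properTwoModelPatchingAt_of_relLUAt k (h p hp k hLU) hLU⟩

/-! ## §2 Load-bearing analysis of the antecedent `RelLUAt k` -/

/-- (A1) The antecedent with the clause `k ⊆ O` DROPPED (so it speaks about every valuation ring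
of `K`). [folklore] -/
def RelLUNoConstAt (k : Type) [Field k] : Prop :=
  ∀ (K : Type) [Field K] [Algebra k K], (⊤ : IntermediateField k K).FG →
    ∀ O : ValuationSubring K, ∀ R : Subalgebra k K, R.FG →
      R.toSubring ≤ O.toSubring → ∃ (A : Subalgebra k K) (h : A.toSubring ≤ O.toSubring),
        R ≤ A ∧ A.FG ∧ IsFractionRing A K ∧ IsRegularLocalRing (Localization.AtPrime
          (Ideal.comap (Subring.inclusion h) (IsLocalRing.maximalIdeal O)))

/-- **(A1) `k ⊆ O` is redundant**: any `k`-subalgebra `R ⊆ O` already contains the constants.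
[folklore] -/
theorem relLUNoConstAt_iff (k : Type) [Field k] : RelLUNoConstAt k ↔ RelLUAt k :=
  ⟨fun h K _ _ hKfg O _ R hRfg hRO => h K hKfg O R hRfg hRO,
    fun h K _ _ hKfg O R hRfg hRO => h K hKfg O (fun c => hRO (R.algebraMap_mem c)) R hRfg hRO⟩

/-- (A2) The antecedent with `IsFractionRing A K` DROPPED from its conclusion (a weaker demand,
hence a STRONGER crux). [folklore] -/
def RelLUNoFracAt (k : Type) [Field k] : Prop :=
  ∀ (K : Type) [Field K] [Algebra k K], (⊤ : IntermediateField k K).FG →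
    ∀ O : ValuationSubring K, (∀ c : k, algebraMap k K c ∈ O) → ∀ R : Subalgebra k K, R.FG →
      R.toSubring ≤ O.toSubring → ∃ (A : Subalgebra k K) (h : A.toSubring ≤ O.toSubring),
        R ≤ A ∧ A.FG ∧ IsRegularLocalRing (Localization.AtPrime
          (Ideal.comap (Subring.inclusion h) (IsLocalRing.maximalIdeal O)))

/-- **(A2) `IsFractionRing A K` is redundant**: enlarge `R` by an affine model of `O` first
(`exists_affineModel`); any `A` above it has fraction field `K`. [folklore] -/
theorem relLUNoFracAt_iff (k : Type) [Field k] : RelLUNoFracAt k ↔ RelLUAt k := by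
  refine ⟨fun h K _ _ hKfg O hO R hRfg hRO => ?_,
    fun h K _ _ hKfg O hO R hRfg hRO => ?_⟩
  · obtain ⟨A₀, hA₀O, hA₀fg, hA₀fr⟩ := exists_affineModel k K hKfg O hO
    have hR'O : (R ⊔ A₀).toSubring ≤ O.toSubring := by
      let Oalg : Subalgebra k K := { O.toSubring with algebraMap_mem' := hO }
      change R ⊔ A₀ ≤ Oalg
      exact sup_le (fun x hx => hRO hx) (fun x hx => hA₀O hx)
    obtain ⟨A, hA, hle, hAfg, hreg⟩ := h K hKfg O hO (R ⊔ A₀) (hRfg.sup hA₀fg) hR'O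
    exact ⟨A, hA, le_sup_left.trans hle, hAfg,
      isFractionRing_of_le (le_sup_right.trans hle) hA₀fr, hreg⟩
  · obtain ⟨A, hA, hle, hAfg, -, hreg⟩ := h K hKfg O hO R hRfg hRO
    exact ⟨A, hA, hle, hAfg, hreg⟩

/-- (A3) The antecedent with REGULARITY AT THE CENTRE dropped. [folklore] -/
def RelLUNoRegAt (k : Type) [Field k] : Prop :=
  ∀ (K : Type) [Field K] [Algebra k K], (⊤ : IntermediateField k K).FG →
    ∀ O : ValuationSubring K, (∀ c : k, algebraMap k K c ∈ O) → ∀ R : Subalgebra k K, R.FG →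
      R.toSubring ≤ O.toSubring → ∃ (A : Subalgebra k K) (_ : A.toSubring ≤ O.toSubring),
        R ≤ A ∧ A.FG ∧ IsFractionRing A K

/-- **(A3) Regularity at the centre is THE content of the antecedent**: without it the
antecedent is a theorem over every field (affine models exist, `exists_affineModel`).
[folklore] -/
theorem relLUNoRegAt_holds (k : Type) [Field k] : RelLUNoRegAt k := by
  intro K _ _ hKfg O hO R hRfg hRO
  obtain ⟨A₀, hA₀O, hA₀fg, hA₀fr⟩ := exists_affineModel k K hKfg O hO
  have hR'O : (R ⊔ A₀).toSubring ≤ O.toSubring := by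
    let Oalg : Subalgebra k K := { O.toSubring with algebraMap_mem' := hO }
    change R ⊔ A₀ ≤ Oalg
    exact sup_le (fun x hx => hRO hx) (fun x hx => hA₀O hx)
  exact ⟨R ⊔ A₀, hR'O, le_sup_left, hRfg.sup hA₀fg, isFractionRing_of_le le_sup_right hA₀fr⟩

/-- (A3) The crux with regularity at the centre dropped from its antecedent. [folklore] -/
def PatchingPerfectWithoutReg : Prop :=
  ∀ p : ℕ, p.Prime → ∀ (k : Type) [Field k] [CharP k p] [PerfectField k],
    RelLUNoRegAt k → ResolvesAt k

/-- **(A3) Dropping regularity collapses the crux to weak resolution over ALL perfect fields** —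
verbatim the antecedent of `DescentPerfectToAll` (stmt-0549), i.e. the summit over perfect
fields: strictly harder than the crux, not a simplification. [folklore] -/
theorem patchingPerfectWithoutReg_iff :
    PatchingPerfectWithoutReg ↔
      ∀ p : ℕ, p.Prime → ∀ (k : Type) [Field k] [CharP k p] [PerfectField k], ResolvesAt k :=
  ⟨fun h p hp k _ _ _ => h p hp k (relLUNoRegAt_holds k), fun h p hp k _ _ _ _ => h p hp k⟩

/-- (A3, cross-check) the right-hand side of `patchingPerfectWithoutReg_iff` is literally the
antecedent of `DescentPerfectToAll` at each prime (definitional). [folklore] -/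
theorem descentPerfectToAll_iff :
    DescentPerfectToAll ↔ ∀ p : ℕ, p.Prime →
      (∀ (k : Type) [Field k] [CharP k p] [PerfectField k], ResolvesAt k) →
        ResolutionInChar.{0} p :=
  Iff.rfl

/-- (A4) The antecedent with finite generation of the PRESCRIBED algebra `R` dropped.
[folklore] -/
def RelLUNoRFGAt (k : Type) [Field k] : Prop :=
  ∀ (K : Type) [Field K] [Algebra k K], (⊤ : IntermediateField k K).FG →
    ∀ O : ValuationSubring K, (∀ c : k, algebraMap k K c ∈ O) → ∀ R : Subalgebra k K,
      R.toSubring ≤ O.toSubring → ∃ (A : Subalgebra k K) (h : A.toSubring ≤ O.toSubring),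
        R ≤ A ∧ A.FG ∧ IsFractionRing A K ∧ IsRegularLocalRing (Localization.AtPrime
          (Ideal.comap (Subring.inclusion h) (IsLocalRing.maximalIdeal O)))

/-- **(A4) `R.FG` is load-bearing — dropping it makes the antecedent FALSE over EVERY field**
(witness `K = k(X)`, `O = K`, `R = K`: a finitely generated `A ⊇ K` makes `k(X)` a finitely
generated `k`-algebra, finite over `k` by Zariski's lemma, contradicting the transcendence of
`X`). The sibling crux `PatchingRel` has this at `𝔽_p` (`Theorems.PatchingRel.Negative.not_lurel_without_rfg`);
the witness is uniform in `k`. [folklore] -/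
theorem not_relLUNoRFGAt (k : Type) [Field k] : ¬ RelLUNoRFGAt k := by
  intro h
  obtain ⟨A, -, hle, hAfg, -, -⟩ := h (FractionRing (Polynomial k))
    (IntermediateField.fg_top_iff.mpr
      (Algebra.EssFiniteType.comp k (Polynomial k) _))
    ⊤ (fun _ => ValuationSubring.mem_top _) ⊤ (fun _ _ => ValuationSubring.mem_top _)
  have htop : (⊤ : Subalgebra k (FractionRing (Polynomial k))).FG := by
    rwa [← eq_top_iff.mpr hle]
  haveI : Algebra.FiniteType k (FractionRing (Polynomial k)) := ⟨htop⟩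
  haveI : Module.Finite k (FractionRing (Polynomial k)) :=
    finite_of_finite_type_of_isJacobsonRing k _
  have hT : Transcendental k
      (algebraMap (Polynomial k) (FractionRing (Polynomial k)) Polynomial.X) :=
    (transcendental_algebraMap_iff (IsFractionRing.injective (Polynomial k) _)).mpr
      (Polynomial.transcendental_X k)
  exact hT (Algebra.IsAlgebraic.isAlgebraic _)

/-- (A4) The crux with `R.FG` dropped from its antecedent. [folklore] -/
def PatchingPerfectWithoutRFG : Prop :=
  ∀ p : ℕ, p.Prime → ∀ (k : Type) [Field k] [CharP k p] [PerfectField k],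
    RelLUNoRFGAt k → ResolvesAt k

/-- **(A4) … so that variant of the crux holds VACUOUSLY** — a trap, not a proof of anything
about resolution. [folklore] -/
theorem patchingPerfectWithoutRFG_holds : PatchingPerfectWithoutRFG :=
  fun _ _ k _ _ _ h => absurd h (not_relLUNoRFGAt k)

/-- (A5) The antecedent with finite generation of `K/k` dropped. [folklore] -/
def RelLUNoKFGAt (k : Type) [Field k] : Prop :=
  ∀ (K : Type) [Field K] [Algebra k K],
    ∀ O : ValuationSubring K, (∀ c : k, algebraMap k K c ∈ O) → ∀ R : Subalgebra k K, R.FG →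
      R.toSubring ≤ O.toSubring → ∃ (A : Subalgebra k K) (h : A.toSubring ≤ O.toSubring),
        R ≤ A ∧ A.FG ∧ IsFractionRing A K ∧ IsRegularLocalRing (Localization.AtPrime
          (Ideal.comap (Subring.inclusion h) (IsLocalRing.maximalIdeal O)))

/-- No finitely generated `k`-subalgebra of `k(X₀, X₁, …)` has it as fraction field: the
transcendence degree of `k(X₀, X₁, …)` is `ℵ₀` (`MvPolynomial.trdeg_of_isDomain`,
`trdeg_add_eq`), that of the fraction field of a finitely generated domain is finite (tree
`exists_ringKrullDim_eq_and_trdeg_eq`, `trdeg_eq_trdeg_of_isFractionRing`). [folklore] -/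
theorem not_exists_fg_isFractionRing_mvPolynomial (k : Type) [Field k] :
    ¬ ∃ A : Subalgebra k (FractionRing (MvPolynomial ℕ k)),
      A.FG ∧ IsFractionRing A (FractionRing (MvPolynomial ℕ k)) := by
  rintro ⟨A, hfg, hfr⟩
  haveI : Algebra.FiniteType k A := A.fg_iff_finiteType.mp hfg
  obtain ⟨n, -, htr⟩ := exists_ringKrullDim_eq_and_trdeg_eq k A
  have h1 : Algebra.trdeg k (FractionRing (MvPolynomial ℕ k)) = n := by
    rw [trdeg_eq_trdeg_of_isFractionRing A, htr]
  have h2 : Algebra.trdeg k (FractionRing (MvPolynomial ℕ k)) = Cardinal.aleph0 := by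
    haveI : Algebra.IsAlgebraic (MvPolynomial ℕ k) (FractionRing (MvPolynomial ℕ k)) :=
      IsLocalization.isAlgebraic (FractionRing (MvPolynomial ℕ k))
        (nonZeroDivisors (MvPolynomial ℕ k))
    rw [← trdeg_add_eq k (MvPolynomial ℕ k) (A := FractionRing (MvPolynomial ℕ k)),
      trdeg_eq_zero (R := MvPolynomial ℕ k) (A := FractionRing (MvPolynomial ℕ k)), add_zero,
      MvPolynomial.trdeg_of_isDomain, Cardinal.mk_nat]
    simp
  rw [h1] at h2
  exact (Cardinal.natCast_lt_aleph0 (n := n)).ne h2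

/-- **(A5) `(⊤ : IntermediateField k K).FG` is load-bearing — dropping it makes the antecedent
FALSE over EVERY field** (witness `K = k(X₀, X₁, …)`, `O = K`, `R = ⊥`: no finitely generated
`A` has fraction field `K`, `not_exists_fg_isFractionRing_mvPolynomial`; the sibling's tree
lemma `not_lurel_without_fg` is the `𝔽_p`, `K = 𝔽_p^alg` instance). [folklore] -/
theorem not_relLUNoKFGAt (k : Type) [Field k] : ¬ RelLUNoKFGAt k := by
  intro h
  obtain ⟨A, -, -, hfg, hfr, -⟩ := h (FractionRing (MvPolynomial ℕ k)) ⊤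
    (fun c => ValuationSubring.mem_top _) ⊥ Subalgebra.fg_bot (fun x _ => trivial)
  exact not_exists_fg_isFractionRing_mvPolynomial k ⟨A, hfg, hfr⟩

/-- (A5) The crux with finite generation of `K/k` dropped from its antecedent. [folklore] -/
def PatchingPerfectWithoutKFG : Prop :=
  ∀ p : ℕ, p.Prime → ∀ (k : Type) [Field k] [CharP k p] [PerfectField k],
    RelLUNoKFGAt k → ResolvesAt k

/-- **(A5) … so that variant of the crux holds VACUOUSLY over every perfect field** — a trap.
[folklore] -/
theorem patchingPerfectWithoutKFG_holds : PatchingPerfectWithoutKFG :=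
  fun _ _ k _ _ _ h => absurd h (not_relLUNoKFGAt k)

/-- (A6) The crux with `PerfectField k` dropped — Zariski patching over EVERY field of
characteristic `p`, fieldwise. [folklore] -/
def PatchingAllFields : Prop :=
  ∀ p : ℕ, p.Prime → ∀ (k : Type) [Field k] [CharP k p], RelLUAt k → ResolvesAt k

/-- **(A6) `PerfectField k` is a RESTRICTION only**: the all-fields statement implies the crux,
and no step of the engine (`resolvesAt_of_properTwoModelPatchingAt_of_relLUAt`,
`relLUAt_of_resolvesAt`, `patchingPerfect_iff_relLU_imp_properTwoModelPatching`) consumes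
perfectness. Not refutable either way. [folklore] -/
theorem patchingPerfect_of_patchingAllFields (h : PatchingAllFields) : PatchingPerfect :=
  fun p hp k _ _ _ => h p hp k

/-- Route `AbhyankarShadows`'s cruxes K1 (`SemivaluationShadows`), K2 (`ShadowsUniformize`) and
its support `RationalSuffices` give relative LU over every ALGEBRAICALLY CLOSED field of
characteristic `p` (the inner term of the route's `closes`). [folklore] -/
theorem relLUAt_of_shadows (h1 : SemivaluationShadows) (h2 : ShadowsUniformize)
    (h3 : RationalSuffices) (p : ℕ) (hp : p.Prime) (k : Type) [Field k] [CharP k p]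
    [IsAlgClosed k] : RelLUAt k :=
  h3 p hp k (fun K _ _ hfg O hO hrat R hR hRO =>
    h2 p hp k K hfg O hO hrat R hR hRO (fun F => h1 p hp k K hfg O hO hrat R hR hRO F))

/-- (A6″) The slice of the crux that route `AbhyankarShadows` actually CONSUMES: Zariski patching
over ALGEBRAICALLY CLOSED fields only (its `closes` feeds `PatchingPerfect` the field produced by
`DescentAlgclosedToPerfect`, which is algebraically closed). [folklore] -/
def PatchingAlgClosed : Prop :=
  ∀ p : ℕ, p.Prime → ∀ (k : Type) [Field k] [CharP k p] [IsAlgClosed k], RelLUAt k → ResolvesAt k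

/-- (A6″) The crux implies its algebraically closed slice (an algebraically closed field is
perfect). [folklore] -/
theorem patchingAlgClosed_of_patchingPerfect (h : PatchingPerfect) : PatchingAlgClosed :=
  fun p hp k _ _ _ => h p hp k

/-- **(A6″) Route `AbhyankarShadows` OVER-ASKS at this crux**: its deciding theorem goes through
verbatim with `PatchingPerfect` weakened to `PatchingAlgClosed` (and with the support
`RationalSuffices` discharged by the landed `Theorems.rationalSuffices_proof`). A planner may
restate the crux at algebraically closed `k` for this route without losing the summit; the
shared item with `IndSmooth` (which needs all perfect `k`) would then split. Informational —
neither slice is refutable. [folklore] -/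
theorem summit_of_patchingAlgClosed (h1 : SemivaluationShadows) (h2 : ShadowsUniformize)
    (hP : PatchingAlgClosed) (hD1 : AbhyankarShadows.DescentAlgclosedToPerfect)
    (hD2 : DescentPerfectToAll) : _root_.ResolutionOfSingularities := fun p hp =>
  hD2 p hp (hD1 p hp (fun k _ _ _ X f hs hl hq hr =>
    hP p hp k (relLUAt_of_shadows h1 h2 Theorems.rationalSuffices_proof p hp k) X f hs hl hq hr))

/-- (A6′) Relative LU over `k` demanded only at valuation rings that are ZERO-DIMENSIONAL
(closed points of the Zariski–Riemann space: every `x ∈ O` is a root modulo `𝔪_O` of a non-zero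
polynomial over `k`) and NOT Abhyankar places of `K | k` — the hard core. [cite: KnafKuhlmann2005, Thm. 1.1]
[cite: ZariskiSamuel1960, Ch. VI §17] -/
def RelLUHardAt (k : Type) [Field k] : Prop :=
  ∀ (K : Type) [Field K] [Algebra k K], (⊤ : IntermediateField k K).FG →
    ∀ O : ValuationSubring K, (∀ c : k, algebraMap k K c ∈ O) →
      (∀ x ∈ O, ∃ f : Polynomial k, f ≠ 0 ∧ Polynomial.aeval x f ∈ O.nonunits) →
      ¬ IsAbhyankarPlace O (algebraMap k K).fieldRange ⊤ →
      ∀ R : Subalgebra k K, R.FG →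
      R.toSubring ≤ O.toSubring → ∃ (A : Subalgebra k K) (h : A.toSubring ≤ O.toSubring),
        R ≤ A ∧ A.FG ∧ IsFractionRing A K ∧ IsRegularLocalRing (Localization.AtPrime
          (Ideal.comap (Subring.inclusion h) (IsLocalRing.maximalIdeal O)))

/-- **(A6′) What perfectness DOES buy, on the antecedent's side: over a perfect `k`, relative LU
is equivalent to its hard core at zero-dimensional non-Abhyankar valuation rings.** Refine `O` to
a valuation ring `O'` minimal over `R` (zero-dimensional, tree `exists_minimal_valuationSubring_le`
/ `exists_aeval_mem_nonunits_of_minimal`); if `O'` is an Abhyankar place it is uniformizable for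
free (Knaf–Kuhlmann 2005 Thm. 1.1 over a perfect ground field, tree
`relLU_at_abhyankarPlace_of_perfectField`); regularity at the centre of `O'` descends to the
coarsening `O` (tree `isRegularLocalRing_centre_of_le`, Serre). For route `AbhyankarShadows`:
its cruxes K1/K2 need only ever be fed NON-Abhyankar rational `O` (Teissier's own scope).
[cite: KnafKuhlmann2005, Thm. 1.1 and Cor. 2.2] -/
theorem relLUAt_iff_hard (k : Type) [Field k] [PerfectField k] : RelLUAt k ↔ RelLUHardAt k := by
  refine ⟨fun h K _ _ hKfg O hO _ _ R hRfg hRO => h K hKfg O hO R hRfg hRO,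
    fun h K _ _ hKfg O hO R hRfg hRO => ?_⟩
  obtain ⟨O', hO'O, hRO', hmin⟩ := exists_minimal_valuationSubring_le R O hRO
  have hO' : ∀ c : k, algebraMap k K c ∈ O' := fun c => hRO' (R.algebraMap_mem c)
  have hzd := exists_aeval_mem_nonunits_of_minimal R hRfg O' hRO' hmin
  suffices hLU' : ∃ (A : Subalgebra k K) (h : A.toSubring ≤ O'.toSubring),
      R ≤ A ∧ A.FG ∧ IsFractionRing A K ∧ IsRegularLocalRing (Localization.AtPrime
        (Ideal.comap (Subring.inclusion h) (IsLocalRing.maximalIdeal O'))) by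
    obtain ⟨A, hA, hRA, hAfg, hfr, hreg⟩ := hLU'
    exact ⟨A, fun x hx => hO'O (hA hx), hRA, hAfg, hfr,
      isRegularLocalRing_centre_of_le A hO'O hA _ hreg⟩
  by_cases hAbh : IsAbhyankarPlace O' (algebraMap k K).fieldRange ⊤
  · exact relLU_at_abhyankarPlace_of_perfectField hKfg O' hO' hAbh R hRfg hRO'
  · exact h K hKfg O' hO' hzd hAbh R hRfg hRO'

/-- (A6′) Hence the crux, with its antecedent cut down to the hard core (equivalent statement,
using perfectness exactly once). [folklore] -/
theorem patchingPerfect_iff_hard :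
    PatchingPerfect ↔ ∀ p : ℕ, p.Prime → ∀ (k : Type) [Field k] [CharP k p] [PerfectField k],
      RelLUHardAt k → ResolvesAt k :=
  ⟨fun h p hp k _ _ _ hLU => h p hp k ((relLUAt_iff_hard k).mpr hLU),
    fun h p hp k _ _ _ hLU => h p hp k ((relLUAt_iff_hard k).mp hLU)⟩

/-! ## §3 Consequent mutations (natural strengthenings, refuted unconditionally) -/

/-- (C1) The consequent with `IsReduced X` DROPPED. [folklore] -/
def ResolvesNoReducedAt (k : Type) [Field k] : Prop :=
  ∀ (X : Scheme.{0}) (f : X ⟶ Spec (.of k)), IsSeparated f → LocallyOfFiniteType f →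
    QuasiCompact f → Scheme.HasResolution X

/-- **(C1) Over EVERY field the consequent without `IsReduced` is false**: `Spec k[ε] → Spec k`
is affine of finite type, and `Spec k[ε]` has no resolution (tree
`not_hasResolution_spec_dualNumber`: a regular stalk on the dense open is a domain, but `ε/1` is a
non-zero nilpotent). [cite: Matsumura1987, Thm. 14.3] -/
theorem not_resolvesNoReducedAt (k : Type) [Field k] : ¬ ResolvesNoReducedAt k := by
  intro h
  haveI : Module.Finite k (DualNumber k) := inferInstanceAs (Module.Finite k (k × k))
  let f : Spec (.of (DualNumber k)) ⟶ Spec (.of k) :=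
    Spec.map (CommRingCat.ofHom (algebraMap k (DualNumber k)))
  haveI : LocallyOfFiniteType f :=
    (HasRingHomProperty.Spec_iff (P := @LocallyOfFiniteType)).mpr
      (RingHom.finiteType_algebraMap.mpr inferInstance)
  exact not_hasResolution_spec_dualNumber k (h _ f inferInstance inferInstance inferInstance)

/-- (C1) The crux with `IsReduced` dropped from its consequent. [folklore] -/
def PatchingPerfectWithoutReduced : Prop :=
  ∀ p : ℕ, p.Prime → ∀ (k : Type) [Field k] [CharP k p] [PerfectField k],
    RelLUAt k → ResolvesNoReducedAt k

/-- **(C1) `IsReduced` is load-bearing: dropped, the crux becomes the NEGATION of its own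
antecedent over every perfect field** (so it would assert that local uniformization fails over
every perfect field of every prime characteristic). [folklore] -/
theorem patchingPerfectWithoutReduced_iff :
    PatchingPerfectWithoutReduced ↔
      ∀ p : ℕ, p.Prime → ∀ (k : Type) [Field k] [CharP k p] [PerfectField k], ¬ RelLUAt k :=
  ⟨fun h p hp k _ _ _ hLU => not_resolvesNoReducedAt k (h p hp k hLU),
    fun h p hp k _ _ _ hLU => absurd hLU (h p hp k)⟩

/-- **(C1) … and is therefore INCONSISTENT with route `IndSmooth`'s target `LurelPerfect`**
(stmt-16086), at `k = 𝔽₂`. [folklore] -/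
theorem patchingPerfectWithoutReduced_refutes_lurelPerfect (h : PatchingPerfectWithoutReduced) :
    ¬ IndSmooth.LurelPerfect := by
  intro hL
  haveI : Fact (Nat.Prime 2) := ⟨Nat.prime_two⟩
  exact patchingPerfectWithoutReduced_iff.mp h 2 Nat.prime_two (ZMod 2)
    (lurelPerfect_iff.mp hL 2 Nat.prime_two (ZMod 2))

/-- **(C1) … and INCONSISTENT with the two remaining cruxes of route `AbhyankarShadows`**
(K1 ∧ K2; the support `RationalSuffices` is the landed `Theorems.rationalSuffices_proof`), at
`k = 𝔽₂^alg` (perfect, being algebraically closed). [folklore] -/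
theorem patchingPerfectWithoutReduced_inconsistent_shadows (h : PatchingPerfectWithoutReduced)
    (h1 : SemivaluationShadows) (h2 : ShadowsUniformize) : False := by
  haveI : Fact (Nat.Prime 2) := ⟨Nat.prime_two⟩
  exact patchingPerfectWithoutReduced_iff.mp h 2 Nat.prime_two (AlgebraicClosure (ZMod 2))
    (relLUAt_of_shadows h1 h2 Theorems.rationalSuffices_proof 2 Nat.prime_two
      (AlgebraicClosure (ZMod 2)))

/-- (C2) The consequent with `LocallyOfFiniteType f` DROPPED. [folklore] -/
def ResolvesNoFTAt (k : Type) [Field k] : Prop :=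
  ∀ (X : Scheme.{0}) (f : X ⟶ Spec (.of k)), IsSeparated f → QuasiCompact f → IsReduced X →
    Scheme.HasResolution X

section Witness

open Polynomial

variable (k : Type) [Field k]

/-- `k[X] → k[X]⁺` (the integral closure of `k[X]` in an algebraic closure of `k(X)`) is
injective. The tree's `absoluteIntegralClosure_algebraMap_injective` at `𝔽_p`, verbatim over
any field. [folklore] -/
theorem absIntClosure_algebraMap_injective :
    Function.Injective (algebraMap k[X]
      ↥(integralClosure k[X] (AlgebraicClosure (RatFunc k)))) := by
  have h : Function.Injective (algebraMap k[X] (AlgebraicClosure (RatFunc k))) := by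
    rw [IsScalarTower.algebraMap_eq k[X] (RatFunc k) (AlgebraicClosure (RatFunc k))]
    exact (algebraMap (RatFunc k) _).injective.comp (RatFunc.algebraMap_injective k)
  intro a b hab
  apply h
  have := congrArg
    (fun x : ↥(integralClosure k[X] (AlgebraicClosure (RatFunc k))) =>
      (x : AlgebraicClosure (RatFunc k))) hab
  simpa using this

/-- Every element of `k[X]⁺` is a square. [folklore] -/
theorem absIntClosure_exists_sq_eq
    (a : ↥(integralClosure k[X] (AlgebraicClosure (RatFunc k)))) :
    ∃ b : ↥(integralClosure k[X] (AlgebraicClosure (RatFunc k))), b ^ 2 = a := by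
  obtain ⟨z, hz⟩ := IsAlgClosed.exists_pow_nat_eq (a : AlgebraicClosure (RatFunc k)) two_pos
  have hzint : IsIntegral k[X] z := IsIntegral.of_pow two_pos (by rw [hz]; exact a.2)
  exact ⟨⟨z, hzint⟩, Subtype.ext hz⟩

/-- The generic point of `Spec k[X]⁺` is not open: every non-zero `f` avoids some non-zero prime
(a prime over `(π)`, `π` an irreducible factor of `c·X + 1`, `c ≠ 0` the constant term of an
integral equation of `f`). The tree's `absoluteIntegralClosure_exists_prime_not_mem` at `𝔽_p`,
verbatim over any field. [folklore] -/
theorem absIntClosure_exists_prime_not_mem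
    (f : ↥(integralClosure k[X] (AlgebraicClosure (RatFunc k)))) (hf : f ≠ 0) :
    ∃ Q : Ideal ↥(integralClosure k[X] (AlgebraicClosure (RatFunc k))),
      Q.IsPrime ∧ Q ≠ ⊥ ∧ f ∉ Q := by
  have hinj := absIntClosure_algebraMap_injective k
  haveI : FaithfulSMul k[X] ↥(integralClosure k[X] (AlgebraicClosure (RatFunc k))) :=
    (faithfulSMul_iff_algebraMap_injective _ _).mpr hinj
  -- an integral equation of `f` with non-zero constant term `c`
  obtain ⟨P, hPm, hPf⟩ := (integralClosure.isIntegral f : IsIntegral k[X] f)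
  obtain ⟨P', hP, hXP'⟩ := P.exists_eq_pow_rootMultiplicity_mul_and_not_dvd hPm.ne_zero 0
  simp only [map_zero, sub_zero] at hP hXP'
  set c := P'.coeff 0 with hc_def
  have hc : c ≠ 0 := fun h0 => hXP' (Polynomial.X_dvd_iff.mpr h0)
  have hP'f : Polynomial.aeval f P' = 0 := by
    have h1 : Polynomial.aeval f P = 0 := hPf
    rw [hP, map_mul, map_pow, Polynomial.aeval_X] at h1
    exact (mul_eq_zero.mp h1).resolve_left (pow_ne_zero _ hf)
  have hrel : algebraMap k[X] _ c = -(Polynomial.aeval f P'.divX * f) := by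
    have h1 := hP'f
    rw [← Polynomial.divX_mul_X_add P', map_add, map_mul, Polynomial.aeval_X,
      Polynomial.aeval_C] at h1
    linear_combination h1
  -- a non-zero prime `(π)` of `k[X]` with `π ∤ c`: an irreducible factor of `c·X + 1`
  have hdeg : (c * X + 1 : k[X]).natDegree = c.natDegree + 1 := by
    rw [Polynomial.natDegree_add_eq_left_of_natDegree_lt] <;>
      rw [Polynomial.natDegree_mul_X hc]
    simp
  have hne : (c * X + 1 : k[X]) ≠ 0 := by
    intro h0; rw [h0] at hdeg; simp at hdeg
  have hnu : ¬ IsUnit (c * X + 1 : k[X]) := by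
    intro hu
    have := Polynomial.natDegree_eq_zero_of_isUnit hu
    omega
  obtain ⟨π, hπirr, hπdvd⟩ := WfDvdMonoid.exists_irreducible_factor hnu hne
  have hπc : ¬ π ∣ c := by
    intro hdc
    apply hπirr.not_isUnit
    have : π ∣ (c * X + 1) - c * X := dvd_sub hπdvd (dvd_mul_of_dvd_left hdc _)
    exact isUnit_of_dvd_one (by simpa using this)
  let 𝔭 : Ideal k[X] := Ideal.span {π}
  haveI h𝔭 : 𝔭.IsPrime := (Ideal.span_singleton_prime hπirr.ne_zero).mpr hπirr.prime
  -- lying over `𝔭`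
  obtain ⟨Q, -, hQ, hQcomap⟩ := Ideal.exists_ideal_over_prime_of_isIntegral 𝔭
    (⊥ : Ideal ↥(integralClosure k[X] (AlgebraicClosure (RatFunc k))))
    (by
      intro a ha
      have ha0 : algebraMap k[X]
          ↥(integralClosure k[X] (AlgebraicClosure (RatFunc k))) a = 0 :=
        Ideal.mem_bot.mp (Ideal.mem_comap.mp ha)
      have : a = 0 := hinj (by rw [ha0, map_zero])
      rw [this]; exact 𝔭.zero_mem)
  refine ⟨Q, hQ, ?_, ?_⟩
  · rintro rfl
    have hπmem : π ∈ (⊥ : Ideal ↥(integralClosure k[X]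
        (AlgebraicClosure (RatFunc k)))).comap (algebraMap k[X] _) := by
      rw [hQcomap]; exact Ideal.mem_span_singleton_self π
    have hπ0 : algebraMap k[X]
        ↥(integralClosure k[X] (AlgebraicClosure (RatFunc k))) π = 0 :=
      Ideal.mem_bot.mp (Ideal.mem_comap.mp hπmem)
    exact hπirr.ne_zero (hinj (by rw [hπ0, map_zero]))
  · intro hfQ
    have h1 : algebraMap k[X] _ c ∈ Q := by
      rw [hrel]; exact Q.neg_mem (Q.mul_mem_left _ hfQ)
    have h2 : c ∈ 𝔭 := by rw [← hQcomap]; exact h1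
    exact hπc (Ideal.mem_span_singleton.mp h2)

/-- **`Spec k[X]⁺` has no resolution of singularities**, for every field `k` (tree
`not_hasResolution_spec_of_forall_exists_pow_eq`: a root-closed domain is Noetherian only at the
generic point, which is not open). [folklore] -/
theorem not_hasResolution_spec_absIntClosure :
    ¬ Scheme.HasResolution (Spec (.of ↥(integralClosure k[X] (AlgebraicClosure (RatFunc k))))) :=
  not_hasResolution_spec_of_forall_exists_pow_eq _ le_rfl (absIntClosure_exists_sq_eq k)
    (absIntClosure_exists_prime_not_mem k)

end Witness

/-- **(C2) Over EVERY field the consequent without `LocallyOfFiniteType` is false**: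
`Spec k[X]⁺ → Spec k` is affine (separated, quasi-compact) with reduced source and no
resolution. [folklore] -/
theorem not_resolvesNoFTAt (k : Type) [Field k] : ¬ ResolvesNoFTAt k := by
  intro h
  let f : Spec (.of ↥(integralClosure (Polynomial k) (AlgebraicClosure (RatFunc k)))) ⟶
      Spec (.of k) :=
    Spec.map (CommRingCat.ofHom ((algebraMap (Polynomial k)
      ↥(integralClosure (Polynomial k) (AlgebraicClosure (RatFunc k)))).comp Polynomial.C))
  exact not_hasResolution_spec_absIntClosure k (h _ f inferInstance inferInstance inferInstance)

/-- (C2) The crux with `LocallyOfFiniteType` dropped from its consequent. [folklore] -/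
def PatchingPerfectWithoutFT : Prop :=
  ∀ p : ℕ, p.Prime → ∀ (k : Type) [Field k] [CharP k p] [PerfectField k],
    RelLUAt k → ResolvesNoFTAt k

/-- **(C2) `LocallyOfFiniteType` is load-bearing: dropped, the crux is again the negation of its
own antecedent over every perfect field.** [folklore] -/
theorem patchingPerfectWithoutFT_iff :
    PatchingPerfectWithoutFT ↔
      ∀ p : ℕ, p.Prime → ∀ (k : Type) [Field k] [CharP k p] [PerfectField k], ¬ RelLUAt k :=
  ⟨fun h p hp k _ _ _ hLU => not_resolvesNoFTAt k (h p hp k hLU),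
    fun h p hp k _ _ _ hLU => absurd hLU (h p hp k)⟩

/-- (C2) … inconsistent with `IndSmooth.LurelPerfect`. [folklore] -/
theorem patchingPerfectWithoutFT_refutes_lurelPerfect (h : PatchingPerfectWithoutFT) :
    ¬ IndSmooth.LurelPerfect := by
  intro hL
  haveI : Fact (Nat.Prime 2) := ⟨Nat.prime_two⟩
  exact patchingPerfectWithoutFT_iff.mp h 2 Nat.prime_two (ZMod 2)
    (lurelPerfect_iff.mp hL 2 Nat.prime_two (ZMod 2))

/-- (C2) … inconsistent with K1 ∧ K2 of route `AbhyankarShadows`. [folklore] -/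
theorem patchingPerfectWithoutFT_inconsistent_shadows (h : PatchingPerfectWithoutFT)
    (h1 : SemivaluationShadows) (h2 : ShadowsUniformize) : False := by
  haveI : Fact (Nat.Prime 2) := ⟨Nat.prime_two⟩
  exact patchingPerfectWithoutFT_iff.mp h 2 Nat.prime_two (AlgebraicClosure (ZMod 2))
    (relLUAt_of_shadows h1 h2 Theorems.rationalSuffices_proof 2 Nat.prime_two
      (AlgebraicClosure (ZMod 2)))

/-! ## §4 Targets — the registered birth line `Lines/birth.lean` (skeleton sha 6a1f9252…) -/

/-- (verbatim from `Lines/birth.lean`) Piltant's Axiom 4 in blow-up format over `k`.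
[cite: Piltant2013, §2 Axiom 4] -/
def PrincipalizationAt (k : Type) [Field k] : Prop :=
  ∀ (U : Scheme.{0}) (f : U ⟶ Spec (.of k)),
    IsSeparated f → LocallyOfFiniteType f → QuasiCompact f → IsIntegral U → Scheme.IsRegular U →
    ∀ I : U.IdealSheafData, I ≠ ⊥ →
      ∃ (Q : U.IdealSheafData) (U' : Scheme.{0}) (σ : U' ⟶ U),
        (Q.support : Set U) ⊆ I.support ∧ IsBlowup σ Q ∧ Scheme.IsRegular U' ∧
          IsEffectiveCartier (I.comap σ)

/-- (verbatim from `Lines/birth.lean`) exceptional-admissible desingularization over `k`.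
[cite: Piltant2013, §2 Axiom 4] -/
def ExcAdmissibleAt (k : Type) [Field k] : Prop :=
  ∀ (U V : Scheme.{0}) (f : U ⟶ Spec (.of k)) (η : V ⟶ U) (I : U.IdealSheafData),
    IsSeparated f → LocallyOfFiniteType f → QuasiCompact f → IsIntegral U → Scheme.IsRegular U →
    I ≠ ⊥ → IsBlowup η I →
      ∃ (J : V.IdealSheafData) (V' : Scheme.{0}) (π : V' ⟶ V),
        J ≠ ⊥ ∧ (J.support : Set V) ⊆ η ⁻¹' (I.support : Set U) ∧ IsBlowup π J ∧
          Scheme.IsRegular V'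

/-- (verbatim from `Lines/birth.lean`) Sing-admissible desingularization over `k`.
[cite: Piltant2013, Def. 5.4 and Prop. 5.1] -/
def SingAdmissibleAt (k : Type) [Field k] : Prop :=
  ∀ (U V : Scheme.{0}) (f : U ⟶ Spec (.of k)) (η : V ⟶ U) (I : U.IdealSheafData),
    IsSeparated f → LocallyOfFiniteType f → QuasiCompact f → IsIntegral U → Scheme.IsRegular U →
    I ≠ ⊥ → IsBlowup η I →
      ∃ (J : V.IdealSheafData) (V' : Scheme.{0}) (π : V' ⟶ V),
        J ≠ ⊥ ∧ (∀ x : V, x ∈ J.support → ¬ IsRegularLocalRing (V.presheaf.stalk x)) ∧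
          IsBlowup π J ∧ Scheme.IsRegular V'

/-- (verbatim from `Lines/birth.lean`) RegLe-ification of one morphism of projective models
over `k`. [cite: Piltant2013, Prop. 5.1 (proof, Steps 2 and 4)] -/
def ProjRegLeificationAt (k : Type) [Field k] : Prop :=
  ∀ (K : Type) [Field K] [Algebra k K] (M Y : ProjModel k K) (φ : M.Hom Y),
    ∃ (M' : ProjModel k K) (ψ : M'.Hom M), ψ.RegLe ∧ (ψ.comp φ).RegLe

/-- (verbatim from `Lines/birth.lean`) two-model patching of projective models over `k`.
[cite: Piltant2013, Prop. 5.1 (P = P_reg) and p. 2] -/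
def ProjTwoModelPatchingAt (k : Type) [Field k] : Prop :=
  ∀ (K : Type) [Field K] [Algebra k K] [Algebra.EssFiniteType k K], ∀ M₁ M₂ : ProjModel k K,
    ∃ (N : ProjModel k K) (φ₁ : N.Hom M₁) (φ₂ : N.Hom M₂), φ₁.RegLe ∧ φ₂.RegLe

/-- (verbatim `Sig.stub_principalizationPerfect` of `Lines/birth.lean`). [cite: Piltant2013, §2 Axiom 4] -/
def StubPrincipalizationPerfect : Prop :=
  ∀ p : ℕ, p.Prime → ∀ (k : Type) [Field k] [CharP k p] [PerfectField k], PrincipalizationAt k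

/-- (verbatim `Sig.stub_badPointsPerfect` of `Lines/birth.lean`). [cite: Piltant2013, Def. 5.4] -/
def StubBadPointsPerfect : Prop :=
  ∀ p : ℕ, p.Prime → ∀ (k : Type) [Field k] [CharP k p] [PerfectField k],
    ExcAdmissibleAt k → SingAdmissibleAt k

/-! ### §4.0 Target `stub_liu2002` — CLOSED in the tree -/

/-- **Target `stub_liu2002` is a theorem of the tree** (`Liu2002Thm8124Projective_holds`,
`ProjectiveBirationalBlowupProofs.lean`, landed before the skeleton was registered; the skeleton
vet said so too): `exact Liu2002Thm8124Projective_holds`. [cite: Liu2002, Thm. 8.1.24] -/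
theorem stub_liu2002_holds : Liu2002Thm8124Projective.{0} :=
  Liu2002Thm8124Projective_holds

/-! ### §4.1 The two open stubs, fieldwise: stub 1 ⟺ ExcAdm; stub 1 ∧ stub 2 ⟺ SingAdm -/

/-- Axiom 4 ⇒ exceptional-admissible desingularization at one field (Stacks 080A backwards; the
skeleton's own `excAdmissibleAt_of_principalizationAt`, verbatim). [cite: StacksProject, Tag 080A] -/
theorem excAdmissibleAt_of_principalizationAt {k : Type} [Field k] (hP : PrincipalizationAt k) :
    ExcAdmissibleAt k := by
  intro U V f η I hf₁ hf₂ hf₃ hU hUreg hI hη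
  haveI := hf₁; haveI := hf₂; haveI := hf₃; haveI := hU
  obtain ⟨Q, U', σ, hQI, hσ, hreg, hcart⟩ := hP U f hf₁ hf₂ hf₃ hU hUreg I hI
  obtain ⟨V', π, hπ, hreg'⟩ := exists_isBlowup_comap_isRegular hσ hreg hcart hη
  refine ⟨Q.comap η, V', π, ?_, ?_, hπ, hreg'⟩
  · intro h
    have hsupp : ((Q.comap η).support : Set V) = Set.univ := by
      rw [h, Scheme.IdealSheafData.support_bot]; rfl
    rw [Scheme.IdealSheafData.support_comap] at hsupp
    obtain ⟨u, hu⟩ := centreCompl_nonempty (J := I) hI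
    let W : U.Opens := ⟨(I.support : Set U)ᶜ, I.support.isClosed.isOpen_compl⟩
    haveI : IsIso (η ∣_ W) := hη.isIso_compl
    obtain ⟨v, hv⟩ := (ConcreteCategory.bijective_of_isIso (η ∣_ W).base).2 ⟨u, hu⟩
    have hηv : η ((η ⁻¹ᵁ W).ι v) = u := by
      have := morphismRestrict_base_coe η W v
      rw [hv] at this
      exact this.symm
    have hmem : (η ⁻¹ᵁ W).ι v ∈ (TopologicalSpace.Closeds.preimage (Q.support) η.continuous :
        Set V) := by rw [hsupp]; trivial
    rw [TopologicalSpace.Closeds.coe_preimage, Set.mem_preimage, hηv] at hmem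
    exact hu (hQI hmem)
  · intro v hv
    rw [Scheme.IdealSheafData.support_comap] at hv
    exact hQI hv

/-- Exceptional-admissible desingularization ⇒ Axiom 4 at one field (Temkin 2008 Lemma 2.1.4:
the composite `Bl_J (Bl_I U) → Bl_I U → U` is ONE `V(I)`-supported blowing up; the tree's
`principalizationInChar_of_regularBlowupExcAdmissible` with its hypothesis taken at the single
field `k` — its proof, verbatim). [cite: Temkin2008, Lemma 2.1.4] [cite: Piltant2013, §2 Axiom 4] -/
theorem principalizationAt_of_excAdmissibleAt {k : Type} [Field k] (h : ExcAdmissibleAt k) :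
    PrincipalizationAt k := by
  intro U f hf₁ hf₂ hf₃ hU hUreg I hI
  haveI := hf₁; haveI := hf₂; haveI := hf₃; haveI := hU
  haveI : IsLocallyNoetherian U := LocallyOfFiniteType.isLocallyNoetherian f
  haveI : CompactSpace U := QuasiCompact.compactSpace_of_compactSpace f
  haveI : IsNoetherian U := {}
  let η : blowup I ⟶ U := blowup.π I
  have hη : IsBlowup η I := blowup.isBlowup I
  obtain ⟨J, V', π, hJ, hJexc, hπ, hreg⟩ := h U (blowup I) f η I hf₁ hf₂ hf₃ hU hUreg hI hη
  obtain ⟨Q, hQ, hQT⟩ :=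
    hη.exists_isBlowup_comp_supported η I π J (I.support : Set U) subset_rfl hπ hJexc
  refine ⟨Q, V', π ≫ η, hQT, hQ, hreg, ?_⟩
  haveI : IsIntegral (blowup I) := hη.isIntegral hI
  haveI : IsIntegral V' := hπ.isIntegral hJ
  haveI : IsDominant π := (hπ.isBirational' hJ).isDominant
  haveI : IsProper η := hη.isProper
  haveI : IsLocallyNoetherian (blowup I) := LocallyOfFiniteType.isLocallyNoetherian (η ≫ f)
  haveI : IsProper π := hπ.isProper
  rw [Scheme.IdealSheafData.comap_comp]
  exact hη.isEffectiveCartier.comap_of_isDominant π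

/-- **Stub 1 at `k` IS exceptional-admissible desingularization at `k`.**
[cite: StacksProject, Tag 080A] [cite: Temkin2008, Lemma 2.1.4] -/
theorem principalizationAt_iff_excAdmissibleAt (k : Type) [Field k] :
    PrincipalizationAt k ↔ ExcAdmissibleAt k :=
  ⟨excAdmissibleAt_of_principalizationAt, principalizationAt_of_excAdmissibleAt⟩

/-- Sing-admissible ⇒ exceptional-admissible at one field (`Sing (Bl_I U) ⊆ η⁻¹ V(I)` for `U`
regular; tree `mem_preimage_support_of_not_isRegular`). [cite: GortzWedhorn2020, Prop. 13.91 (3)] -/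
theorem excAdmissibleAt_of_singAdmissibleAt {k : Type} [Field k] (h : SingAdmissibleAt k) :
    ExcAdmissibleAt k := by
  intro U V f η I hf₁ hf₂ hf₃ hU hUreg hI hη
  obtain ⟨J, V', π, hJ, hJsing, hπ, hreg⟩ := h U V f η I hf₁ hf₂ hf₃ hU hUreg hI hη
  exact ⟨J, V', π, hJ, fun v hv => mem_preimage_support_of_not_isRegular hη hUreg (hJsing v hv),
    hπ, hreg⟩

/-- **THE LINE'S RESIDUAL, exactly**: the two open stubs of `birth` together are EQUIVALENT to
Sing-admissible blow-up desingularization of blowings up of regular varieties over every perfect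
field of positive characteristic (`SingAdmissibleAt k`, the per-field slice of the tree conjecture
`RegularBlowupSingAdmissibleResolution p` = the strong blow-up atom SAND⁺ᵇ of the sibling crux
`PatchingRel`'s dead line `sandwiched-gluing`, restricted to `Bl_I U`). The cut "Axiom 4 +
bad points" loses nothing and gains nothing. [cite: Piltant2013, Def. 5.4 and §2 Axiom 4] -/
theorem stubs_iff_singAdmissible_perfect :
    (StubPrincipalizationPerfect ∧ StubBadPointsPerfect) ↔
      ∀ p : ℕ, p.Prime → ∀ (k : Type) [Field k] [CharP k p] [PerfectField k],
        SingAdmissibleAt k :=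
  ⟨fun h p hp k _ _ _ => h.2 p hp k (excAdmissibleAt_of_principalizationAt (h.1 p hp k)),
    fun h => ⟨fun p hp k _ _ _ => principalizationAt_of_excAdmissibleAt
      (excAdmissibleAt_of_singAdmissibleAt (h p hp k)),
      fun p hp k _ _ _ _ => h p hp k⟩⟩

/-- The all-fields tree conjecture gives both stubs (slice to perfect `k`). [folklore] -/
theorem stubs_of_regularBlowupSingAdmissibleResolution
    (h : ∀ p : ℕ, p.Prime → RegularBlowupSingAdmissibleResolution.{0} p) :
    StubPrincipalizationPerfect ∧ StubBadPointsPerfect :=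
  stubs_iff_singAdmissible_perfect.mpr fun p hp k _ _ _ => h p hp k


/-! ### §4.2 SLACK — the pipeline consumes the Sing-admissible atom only at QUASI-PROJECTIVE
regular `U` (namely `U = Reg Y`, `Y` a projective model), and stub 3 not at all -/

/-- Sing-admissible desingularization of blowings up of regular QUASI-PROJECTIVE `k`-varieties —
the per-field slice of the tree conjecture `RegularBlowupSingAdmissibleResolutionQProj p`
(verbatim body). [cite: Piltant2013, p. 2 and Def. 5.4] -/
def SingAdmissibleQProjAt (k : Type) [Field k] : Prop :=
  ∀ (U V : Scheme.{0}) (f : U ⟶ Spec (.of k)) (η : V ⟶ U) (I : U.IdealSheafData),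
    IsSeparated f → LocallyOfFiniteType f → QuasiCompact f → IsIntegral U → Scheme.IsRegular U →
    (∃ (P : Scheme.{0}) (πP : P ⟶ Spec (.of k)) (j : U ⟶ P),
      IsProjectiveOver (Over.mk πP) ∧ IsOpenImmersion j ∧ j ≫ πP = f) →
    I ≠ ⊥ → IsBlowup η I →
      ∃ (J : V.IdealSheafData) (V' : Scheme.{0}) (π : V' ⟶ V),
        J ≠ ⊥ ∧ (∀ x : V, x ∈ J.support → ¬ IsRegularLocalRing (V.presheaf.stalk x)) ∧
          IsBlowup π J ∧ Scheme.IsRegular V'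

/-- The unrestricted atom gives the quasi-projective one (forget the embedding). [folklore] -/
theorem singAdmissibleQProjAt_of_singAdmissibleAt {k : Type} [Field k] (h : SingAdmissibleAt k) :
    SingAdmissibleQProjAt k :=
  fun U V f η I h₁ h₂ h₃ h₄ h₅ _ hI hη => h U V f η I h₁ h₂ h₃ h₄ h₅ hI hη

/-- The all-fields quasi-projective tree conjecture gives the per-field atom. [folklore] -/
theorem singAdmissibleQProjAt_of_regularBlowupSingAdmissibleResolutionQProj {p : ℕ}
    (h : RegularBlowupSingAdmissibleResolutionQProj.{0} p) (k : Type) [Field k] [CharP k p] :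
    SingAdmissibleQProjAt k :=
  fun U V f η I h₁ h₂ h₃ h₄ h₅ hqp hI hη => h k U V f η I h₁ h₂ h₃ h₄ h₅ hqp hI hη

/-- **The quasi-projective atom at `k` ALONE RegLe-ifies morphisms of projective models over
`k`** (Liu 8.1.24 is the tree theorem `Liu2002Thm8124Projective_holds`; the tree's
`projRegLeification_of_liu_of_regularBlowupSingAdmQProj` with its resolver taken at the single
field `k` — its proof verbatim): the only `U` ever fed to the atom is `Reg Y ↪ Y ↪ ℙⁿ_k`, which
is quasi-projective. [cite: Liu2002, Thm. 8.1.24] [cite: Piltant2013, Prop. 5.1 (proof, Steps 2 and 4)] -/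
theorem projRegLeificationAt_of_singAdmissibleQProjAt {k : Type} [Field k]
    (hS : SingAdmissibleQProjAt k) : ProjRegLeificationAt k := by
  intro K _ _ M Y φ
  obtain ⟨I, hI, hφblow⟩ := Liu2002Thm8124Projective_holds k M.X Y.X φ.f M.π Y.π inferInstance
    inferInstance M.isProjectiveOver Y.isProjectiveOver φ.f_π φ.isBirational
  let UY : Y.X.Opens :=
    ⟨Scheme.regularLocus Y.X, isOpen_regularLocus_of_locallyOfFiniteType_field Y.π⟩
  let RM : M.X.Opens :=
    ⟨Scheme.regularLocus M.X, isOpen_regularLocus_of_locallyOfFiniteType_field M.π⟩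
  let V : M.X.Opens := φ.f ⁻¹ᵁ UY
  let O : M.X.Opens := V ⊔ RM
  have hVO : V ≤ O := le_sup_left
  have hgenY : genericPoint Y.X ∈ UY := by
    show genericPoint Y.X ∈ Scheme.regularLocus Y.X
    apply Scheme.genericPoints_subset_regularLocus
    rw [genericPoints_eq_singleton]
    rfl
  haveI : Nonempty (UY : Scheme.{0}) := ⟨⟨_, hgenY⟩⟩
  haveI : IsIntegral (UY : Scheme.{0}) := isIntegral_of_isOpenImmersion UY.ι
  have hUreg : Scheme.IsRegular (UY : Scheme.{0}) := fun u =>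
    (isRegularLocalRing_stalk_iff_of_isOpenImmersion UY.ι u).mp u.2
  have hout : ∀ x : M.X, x ∈ O → x ∉ V → IsRegularLocalRing (M.X.presheaf.stalk x) := by
    intro x hx hxV
    rcases Opens.mem_sup.mp hx with h | h
    · exact absurd h hxV
    · exact h
  have hgenM : genericPoint M.X ∈ RM := by
    show genericPoint M.X ∈ Scheme.regularLocus M.X
    apply Scheme.genericPoints_subset_regularLocus
    rw [genericPoints_eq_singleton]
    rfl
  have hOne : (O : Set M.X).Nonempty := ⟨_, Opens.mem_sup.mpr (Or.inr hgenM)⟩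
  haveI : Nonempty (O : Scheme.{0}) := hOne.to_subtype
  haveI : IsIntegral (O : Scheme.{0}) := isIntegral_of_isOpenImmersion O.ι
  let V' : (O : Scheme.{0}).Opens := O.ι ⁻¹ᵁ V
  let e : (V' : Scheme.{0}) ≅ (V : Scheme.{0}) := Scheme.Opens.isoOfLE hVO
  let η' : (V' : Scheme.{0}) ⟶ (UY : Scheme.{0}) := e.hom ≫ (φ.f ∣_ UY)
  have hη'blow : IsBlowup η' (I.comap UY.ι) := (hφblow.restrict UY).iso_comp e
  have hIne : I.comap UY.ι ≠ ⊥ := by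
    intro h
    have hsupp : ((I.comap UY.ι).support : Set (UY : Scheme.{0})) = Set.univ := by
      rw [h, Scheme.IdealSheafData.support_bot]; rfl
    rw [Scheme.IdealSheafData.support_comap, Closeds.coe_preimage] at hsupp
    have hmem : (⟨genericPoint Y.X, hgenY⟩ : (UY : Scheme.{0})) ∈
        UY.ι ⁻¹' (I.support : Set Y.X) := by
      rw [hsupp]; trivial
    exact not_mem_support_genericPoint hI hmem
  have hout' : ∀ x : (O : Scheme.{0}), x ∉ V' →
      IsRegularLocalRing ((O : Scheme.{0}).presheaf.stalk x) := fun x hx =>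
    (isRegularLocalRing_stalk_iff_of_isOpenImmersion O.ι x).mp (hout x.1 x.2 hx)
  -- the atom, at the QUASI-PROJECTIVE regular `Reg Y ↪ Y`
  obtain ⟨J, N₁, π₁, hJ, hJsing, hπ₁, hreg₁⟩ := hS (UY : Scheme.{0}) (V' : Scheme.{0})
    (UY.ι ≫ Y.π) η' (I.comap UY.ι) inferInstance inferInstance inferInstance inferInstance hUreg
    ⟨Y.X, Y.π, UY.ι, Y.isProjectiveOver, inferInstance, rfl⟩ hIne hη'blow
  obtain ⟨I₀, N₀, π, hI₀, -, hπ, hreg⟩ :=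
    exists_isBlowup_of_isBlowup_opens_of_regular_off (O.ι ≫ M.π) V' hout' hJ hJsing hπ₁ hreg₁
  obtain ⟨Z, ρ, s, hZ, hρ, hbir, hs, hsq, hblow⟩ := exists_isPullback_of_isBlowup_opens O hI₀ hπ
  haveI := hZ
  haveI := hρ
  haveI := hs
  have hproj : IsProjectiveOver (Over.mk (ρ ≫ M.π) : SchemeOver k) :=
    hblow.isProjectiveOver M.π M.isProjectiveOver
  have hregO : ∀ z : Z, ρ z ∈ O → IsRegularLocalRing (Z.presheaf.stalk z) := fun z hz =>
    isRegularLocalRing_stalk_of_isPullback_ι hsq (S := (O : Set M.X)) le_rfl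
      (fun m _ => hreg m) z hz
  obtain ⟨M', ψ, e', hψ⟩ := M.exists_projModel_of_isBirational ρ hbir hproj
  subst e'
  rw [eqToHom_refl, Category.id_comp] at hψ
  refine ⟨M', ψ, fun y hy => ?_, fun y hy => ?_⟩
  · rw [hψ] at hy
    have := hregO y (Opens.mem_sup.mpr (Or.inr hy))
    simpa [hψ] using this
  · rw [ProjModel.Hom.comp_f, Scheme.Hom.comp_apply, hψ] at hy
    have := hregO y (hVO (show φ.f (ρ y) ∈ UY from hy))
    simpa [hψ] using this

/-- RegLe-ification over `k` ⇒ two-model patching of projective models over `k` (RegLe-ify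
twice on the join; tree `Theorems.projTwoModelPatching_of_projRegLeification`, per field).
[cite: Piltant2013, Prop. 5.1 (proof, Step 5)] -/
theorem projTwoModelPatchingAt_of_projRegLeificationAt {k : Type} [Field k]
    (h : ProjRegLeificationAt k) : ProjTwoModelPatchingAt k :=
  fun K _ _ _ M₁ M₂ => projTwoModelPatching_of_projRegLeification (h K) M₁ M₂

/-- The Zariski–Piltant engine at one field (tree, dimension-free; the skeleton's
`resolvesAt_of_projTwoModelPatchingAt_of_relLUAt`, verbatim). [cite: Piltant2013, Prop. 5.1 and Cor. 5.7] -/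
theorem resolvesAt_of_projTwoModelPatchingAt_of_relLUAt {k : Type} [Field k]
    (hZ : ProjTwoModelPatchingAt k) (hLU : RelLUAt k) : ResolvesAt k := by
  intro X f hs hl hq hr
  haveI : QuasiCompact f := hq
  haveI : LocallyOfFiniteType f := hl
  haveI : CompactSpace X := QuasiCompact.compactSpace_of_compactSpace f
  obtain ⟨d, hd⟩ := exists_topologicalKrullDim_le_of_locallyOfFiniteType f
  have hLU' : ∀ (K : Type) [Field K] [Algebra k K] (O : ValuationSubring K) (R : Subalgebra k K),
      R.FG → IsFractionRing R K → R.toSubring ≤ O.toSubring →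
        ∃ (A : Subalgebra k K) (h : A.toSubring ≤ O.toSubring), R ≤ A ∧ A.FG ∧
          IsRegularLocalRing (Localization.AtPrime
            (Ideal.comap (Subring.inclusion h) (IsLocalRing.maximalIdeal O))) := by
    intro K _ _ O R hRfg hRfr hRO
    haveI : Algebra.FiniteType k R := R.fg_iff_finiteType.mp hRfg
    haveI : Algebra.EssFiniteType R K :=
      Algebra.EssFiniteType.of_isLocalization K (nonZeroDivisors R)
    have hKfg : (⊤ : IntermediateField k K).FG :=
      IntermediateField.fg_top_iff.mpr (Algebra.EssFiniteType.comp k R K)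
    obtain ⟨A, h, hle, hAfg, -, hreg⟩ :=
      hLU K hKfg O (fun c => hRO (R.algebraMap_mem c)) R hRfg hRO
    exact ⟨A, h, hle, hAfg, hreg⟩
  exact resolutionOverUpToDim_of_twoModelPatching_of_relLU hZ hLU' d X f hs hl hq hr hd

/-- **SLACK #1 — the crux follows from the QUASI-PROJECTIVE Sing-admissible atom over perfect
fields alone** (no stub 3, no Axiom 4 as a separate input, and the atom never evaluated at a
non-quasi-projective `U`). So the line may weaken BOTH open stubs to quasi-projective regular
`U` (the sibling crux `PatchingRel` did exactly this in its v3.8 cut,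
`stub_sandwichedBlowupResolutionQProj`) at no cost to `PatchingPerfect_of`.
[cite: Piltant2013, Prop. 5.1 and Cor. 5.7] [cite: Liu2002, Thm. 8.1.24] -/
theorem patchingPerfect_of_singAdmissibleQProj_perfect
    (h : ∀ p : ℕ, p.Prime → ∀ (k : Type) [Field k] [CharP k p] [PerfectField k],
      SingAdmissibleQProjAt k) : PatchingPerfect :=
  fun p hp k _ _ _ hLU X f hs hl hq hr =>
    resolvesAt_of_projTwoModelPatchingAt_of_relLUAt
      (projTwoModelPatchingAt_of_projRegLeificationAt
        (projRegLeificationAt_of_singAdmissibleQProjAt (h p hp k))) hLU X f hs hl hq hr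

/-- … in particular from the unrestricted atom over perfect fields, … [folklore] -/
theorem patchingPerfect_of_singAdmissible_perfect
    (h : ∀ p : ℕ, p.Prime → ∀ (k : Type) [Field k] [CharP k p] [PerfectField k],
      SingAdmissibleAt k) : PatchingPerfect :=
  patchingPerfect_of_singAdmissibleQProj_perfect fun p hp k _ _ _ =>
    singAdmissibleQProjAt_of_singAdmissibleAt (h p hp k)

/-- **… and from the two open stubs WITHOUT stub 3** (`stub_liu2002` is a tree theorem): the
skeleton's `PatchingPerfect_of` minus its third hypothesis. [folklore] -/
theorem patchingPerfect_of_two_stubs (h₁ : StubPrincipalizationPerfect)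
    (h₂ : StubBadPointsPerfect) : PatchingPerfect :=
  patchingPerfect_of_singAdmissible_perfect (stubs_iff_singAdmissible_perfect.mp ⟨h₁, h₂⟩)

/-- The same for the `IndSmooth` copy of the shared crux (one term). [folklore] -/
theorem indSmooth_patchingPerfect_of_two_stubs (h₁ : StubPrincipalizationPerfect)
    (h₂ : StubBadPointsPerfect) : IndSmooth.PatchingPerfect :=
  patchingPerfect_of_two_stubs h₁ h₂

/-- The all-fields quasi-projective tree conjecture `RegularBlowupSingAdmissibleResolutionQProj`
(the residual of `PatchingRel`'s line, prime characteristics) already gives this crux.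
[folklore] -/
theorem patchingPerfect_of_regularBlowupSingAdmissibleResolutionQProj
    (h : ∀ p : ℕ, p.Prime → RegularBlowupSingAdmissibleResolutionQProj.{0} p) : PatchingPerfect :=
  patchingPerfect_of_singAdmissibleQProj_perfect fun p hp k _ _ _ =>
    singAdmissibleQProjAt_of_regularBlowupSingAdmissibleResolutionQProj (h p hp) k


/-! ### §4.3 Load-bearing clauses of stub 1 (`PrincipalizationAt k`) — each clause dropped -/

/-- The support of the unit ideal sheaf is empty. [folklore] -/
theorem coe_support_top (X : Scheme.{0}) : (((⊤ : X.IdealSheafData).support : Set X)) = ∅ := by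
  rw [(Scheme.IdealSheafData.support_eq_bot_iff ⊤).mpr rfl, Closeds.coe_bot]

/-- On a non-empty scheme the unit ideal sheaf is not the zero ideal sheaf (their supports are
`∅` and everything). [folklore] -/
theorem top_ne_bot_idealSheafData (X : Scheme.{0}) [h : Nonempty X] :
    (⊤ : X.IdealSheafData) ≠ ⊥ := by
  intro htb
  have h1 := coe_support_top X
  rw [htb, Scheme.IdealSheafData.support_bot, Closeds.coe_top] at h1
  obtain ⟨x⟩ := h
  have hx : x ∈ (Set.univ : Set X) := trivial
  rw [h1] at hx
  exact hx

/-- An ideal sheaf with empty support is the unit ideal sheaf. [folklore] -/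
theorem eq_top_of_support_subset_empty {X : Scheme.{0}} {Q : X.IdealSheafData}
    (h : (Q.support : Set X) ⊆ ∅) : Q = ⊤ := by
  rw [← Scheme.IdealSheafData.support_eq_bot_iff]
  exact Closeds.ext (by rw [Closeds.coe_bot]; exact Set.subset_empty_iff.mp h)

/-- Regularity transports along an isomorphism of schemes. [folklore] -/
theorem isRegular_of_isIso {U' U : Scheme.{0}} (σ : U' ⟶ U) [IsIso σ] (h : Scheme.IsRegular U') :
    Scheme.IsRegular U := by
  intro x
  haveI := h ((inv σ).base x)
  exact IsRegularLocalRing.of_ringEquiv (asIso ((inv σ).stalkMap x)).commRingCatIsoToRingEquiv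

/-- **A `V(⊤)`-supported regular blowing up exists only over a REGULAR scheme**: if `Q` has
support inside that of `⊤` (i.e. empty) and `Bl_Q U` is regular, then `U` is regular (`Q = ⊤`, so
the blowing up is an isomorphism, `IsBlowup.isIso`). The mechanism behind every `I = ⊤` instance
of the stubs. [cite: GortzWedhorn2020, (13.19) p. 413] -/
theorem isRegular_of_isBlowup_support_subset_top {U U' : Scheme.{0}} {Q : U.IdealSheafData}
    {σ : U' ⟶ U} (hQ : (Q.support : Set U) ⊆ ((⊤ : U.IdealSheafData).support : Set U))
    (hσ : IsBlowup σ Q) (hreg : Scheme.IsRegular U') : Scheme.IsRegular U := by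
  rw [coe_support_top] at hQ
  obtain rfl := eq_top_of_support_subset_empty hQ
  haveI : IsIso σ := hσ.isIso isEffectiveCartier_top
  exact isRegular_of_isIso σ hreg

/-- (P1) stub 1's predicate with the clause `IsEffectiveCartier (I.comap σ)` DROPPED. [folklore] -/
def PrincipalizationNoCartierAt (k : Type) [Field k] : Prop :=
  ∀ (U : Scheme.{0}) (f : U ⟶ Spec (.of k)),
    IsSeparated f → LocallyOfFiniteType f → QuasiCompact f → IsIntegral U → Scheme.IsRegular U →
    ∀ I : U.IdealSheafData, I ≠ ⊥ →
      ∃ (Q : U.IdealSheafData) (U' : Scheme.{0}) (σ : U' ⟶ U),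
        (Q.support : Set U) ⊆ I.support ∧ IsBlowup σ Q ∧ Scheme.IsRegular U'

/-- **(P1) the Cartier clause is half of the content: dropped, stub 1 is TRIVIAL over every field**
(`Q = ⊤`, `σ = 𝟙 U`). [folklore] -/
theorem principalizationNoCartierAt_trivial (k : Type) [Field k] : PrincipalizationNoCartierAt k := by
  intro U f _ _ _ _ hUreg I _
  refine ⟨⊤, U, 𝟙 U, ?_, isBlowup_id_top U, hUreg⟩
  rw [coe_support_top]
  exact Set.empty_subset _

/-- (P2) stub 1's predicate with the clause `Scheme.IsRegular U'` DROPPED. [folklore] -/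
def PrincipalizationNoRegSourceAt (k : Type) [Field k] : Prop :=
  ∀ (U : Scheme.{0}) (f : U ⟶ Spec (.of k)),
    IsSeparated f → LocallyOfFiniteType f → QuasiCompact f → IsIntegral U → Scheme.IsRegular U →
    ∀ I : U.IdealSheafData, I ≠ ⊥ →
      ∃ (Q : U.IdealSheafData) (U' : Scheme.{0}) (σ : U' ⟶ U),
        (Q.support : Set U) ⊆ I.support ∧ IsBlowup σ Q ∧ IsEffectiveCartier (I.comap σ)

/-- **(P2) regularity of the source is the other half: dropped, stub 1 is a THEOREM over every
field** (`Q = I`, `σ = Bl_I U → U`, which exists, tree `exists_isBlowup` / `blowup`, and makes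
`I𝒪` an effective Cartier divisor by definition). [cite: GortzWedhorn2020, Def. 13.90 and Prop. 13.92] -/
theorem principalizationNoRegSourceAt_holds (k : Type) [Field k] : PrincipalizationNoRegSourceAt k :=
  fun _ _ _ _ _ _ _ I _ =>
    ⟨I, blowup I, blowup.π I, subset_rfl, blowup.isBlowup I, (blowup.isBlowup I).isEffectiveCartier⟩

/-- (P3) stub 1's predicate with the HYPOTHESIS `Scheme.IsRegular U` DROPPED (Axiom 4 asked on
singular varieties too). [folklore] -/
def PrincipalizationNoRegBaseAt (k : Type) [Field k] : Prop :=
  ∀ (U : Scheme.{0}) (f : U ⟶ Spec (.of k)),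
    IsSeparated f → LocallyOfFiniteType f → QuasiCompact f → IsIntegral U →
    ∀ I : U.IdealSheafData, I ≠ ⊥ →
      ∃ (Q : U.IdealSheafData) (U' : Scheme.{0}) (σ : U' ⟶ U),
        (Q.support : Set U) ⊆ I.support ∧ IsBlowup σ Q ∧ Scheme.IsRegular U' ∧
          IsEffectiveCartier (I.comap σ)

/-- **(P3) mechanism**: without `IsRegular U`, the instance `I = ⊤` forces EVERY integral
separated `k`-scheme of finite type to be regular. [folklore] -/
theorem isRegular_of_principalizationNoRegBaseAt {k : Type} [Field k]
    (h : PrincipalizationNoRegBaseAt k) (U : Scheme.{0}) (f : U ⟶ Spec (.of k)) [IsSeparated f]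
    [LocallyOfFiniteType f] [QuasiCompact f] [IsIntegral U] : Scheme.IsRegular U := by
  obtain ⟨Q, U', σ, hQ, hσ, hreg, -⟩ := h U f ‹_› ‹_› ‹_› ‹_› ⊤ (top_ne_bot_idealSheafData U)
  exact isRegular_of_isBlowup_support_subset_top hQ hσ hreg

/-- **(P3) `Scheme.IsRegular U` is LOAD-BEARING in stub 1: dropped, the statement is FALSE over
every field of positive characteristic** — witness the quadric cone `yz + x² = 0 ⊂ 𝔸³_k`
(integral, affine of finite type, NOT regular at the vertex: tree
`FRationalResolution.suspension_not_isRegular`) with `I = ⊤`. [cite: Matsumura1987, Thm. 14.3] -/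
theorem not_principalizationNoRegBaseAt (k : Type) [Field k] (p : ℕ) [Fact p.Prime] [CharP k p] :
    ¬ PrincipalizationNoRegBaseAt k := by
  intro h
  have hg : (MvPolynomial.X 0 ^ 2 : MvPolynomial (Fin 1) k) ≠ 0 :=
    pow_ne_zero _ (MvPolynomial.X_ne_zero 0)
  let R : Type := MvPolynomial (Fin 2 ⊕ Fin 1) k ⧸ Ideal.span
      {(MvPolynomial.X (Sum.inl 0) * MvPolynomial.X (Sum.inl 1) +
        MvPolynomial.rename Sum.inr (MvPolynomial.X 0 ^ 2) : MvPolynomial (Fin 2 ⊕ Fin 1) k)}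
  let φ : Spec (.of R) ⟶ Spec (.of k) := Spec.map (CommRingCat.ofHom (algebraMap k R))
  obtain ⟨hsep, hft, hqc, -, -, -⟩ :=
    FRationalResolution.suspension_package k 1 (MvPolynomial.X 0 ^ 2) p hg
  haveI := FRationalResolution.isPrime_span_suspension k 1 (MvPolynomial.X 0 ^ 2) hg
  haveI : IsDomain R := Ideal.Quotient.isDomain _
  haveI : IsSeparated φ := hsep
  haveI : LocallyOfFiniteType φ := hft
  haveI : QuasiCompact φ := hqc
  haveI : IsIntegral (Spec (.of R)) := inferInstance
  exact FRationalResolution.suspension_not_isRegular k 1 (MvPolynomial.X 0 ^ 2) p hg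
    (Ideal.pow_mem_pow (Ideal.subset_span (Set.mem_range_self 0)) 2)
    (isRegular_of_principalizationNoRegBaseAt h (Spec (.of R)) φ)

/-- (P4) **the guard `I ≠ ⊥` of stub 1 is NOT load-bearing** — its `I = ⊥` instance is
junk-TRUE: blow up `Q = ⊥`, whose blowing up is the EMPTY scheme (regular, and `⊥𝒪_∅` is an
effective Cartier divisor vacuously). First, the empty scheme is a blowing up along `⊥`: any
`f : W → U` making `f⁻¹V(⊥) = W` an effective Cartier divisor has `W = ∅` (a local equation would be
a regular element vanishing everywhere, tree `nonempty_basicOpen_of_mem_nonZeroDivisors`).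
[cite: GortzWedhorn2020, Def. 13.90] -/
theorem isEmpty_of_isEffectiveCartier_comap_bot {W U : Scheme.{0}} (f : W ⟶ U)
    (hf : IsEffectiveCartier ((⊥ : U.IdealSheafData).comap f)) : IsEmpty W := by
  by_contra hne
  rw [not_isEmpty_iff] at hne
  obtain ⟨x'⟩ := hne
  obtain ⟨V, hxV, g, hg, hV⟩ := hf x'
  obtain ⟨y, hy⟩ := nonempty_basicOpen_of_mem_nonZeroDivisors V hxV g hg
  have hyV : y ∈ (V : W.Opens) := W.basicOpen_le g hy
  have hsupp : y ∈ (((⊥ : U.IdealSheafData).comap f).support : Set W) := by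
    rw [Scheme.IdealSheafData.support_comap]
    change f.base y ∈ ((⊥ : U.IdealSheafData).support : Set U)
    rw [Scheme.IdealSheafData.support_bot]
    trivial
  rw [SetLike.mem_coe, Scheme.IdealSheafData.mem_support_iff_of_mem hyV, hV] at hsupp
  simp only [Scheme.mem_zeroLocus_iff, SetLike.mem_coe] at hsupp
  exact hsupp g (Ideal.mem_span_singleton_self g) hy

/-- (P4) Any morphism from an EMPTY scheme is a blowing up along the zero ideal sheaf.
[cite: GortzWedhorn2020, Def. 13.90] -/
theorem isBlowup_bot_of_isEmpty {E U : Scheme.{0}} [IsEmpty E] (e : E ⟶ U) :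
    IsBlowup e (⊥ : U.IdealSheafData) := by
  refine ⟨fun x => isEmptyElim x, fun W f hf => ?_⟩
  haveI : IsEmpty W := isEmpty_of_isEffectiveCartier_comap_bot f hf
  refine ⟨(isInitialOfIsEmpty (X := W)).to E, (isInitialOfIsEmpty (X := W)).hom_ext _ _,
    fun g _ => (isInitialOfIsEmpty (X := W)).hom_ext _ _⟩

/-- **(P4) the `I = ⊥` instance of stub 1's body HOLDS** (junk-true: `Q = ⊥`, `U' = ∅`), so the
guard `I ≠ ⊥` excludes nothing false — harmless, unlike in stub 2 (`not_singAdmissibleNoNeBotAt`).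
[folklore] -/
theorem principalizationAt_bot_instance {U : Scheme.{0}} :
    ∃ (Q : U.IdealSheafData) (U' : Scheme.{0}) (σ : U' ⟶ U),
      (Q.support : Set U) ⊆ (⊥ : U.IdealSheafData).support ∧ IsBlowup σ Q ∧
        Scheme.IsRegular U' ∧ IsEffectiveCartier ((⊥ : U.IdealSheafData).comap σ) :=
  ⟨⊥, ∅, Scheme.emptyTo U, subset_rfl, isBlowup_bot_of_isEmpty _, fun x => isEmptyElim x,
    fun x => isEmptyElim x⟩

/-! ### §4.4 Load-bearing clauses of stub 2 (`ExcAdmissibleAt k → SingAdmissibleAt k`) -/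

/-- (S1) the Sing-admissible predicate with the guard `I ≠ ⊥` DROPPED. [folklore] -/
def SingAdmissibleNoNeBotAt (k : Type) [Field k] : Prop :=
  ∀ (U V : Scheme.{0}) (f : U ⟶ Spec (.of k)) (η : V ⟶ U) (I : U.IdealSheafData),
    IsSeparated f → LocallyOfFiniteType f → QuasiCompact f → IsIntegral U → Scheme.IsRegular U →
    IsBlowup η I →
      ∃ (J : V.IdealSheafData) (V' : Scheme.{0}) (π : V' ⟶ V),
        J ≠ ⊥ ∧ (∀ x : V, x ∈ J.support → ¬ IsRegularLocalRing (V.presheaf.stalk x)) ∧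
          IsBlowup π J ∧ Scheme.IsRegular V'

/-- (S1) the exceptional-admissible predicate with the guard `I ≠ ⊥` DROPPED. [folklore] -/
def ExcAdmissibleNoNeBotAt (k : Type) [Field k] : Prop :=
  ∀ (U V : Scheme.{0}) (f : U ⟶ Spec (.of k)) (η : V ⟶ U) (I : U.IdealSheafData),
    IsSeparated f → LocallyOfFiniteType f → QuasiCompact f → IsIntegral U → Scheme.IsRegular U →
    IsBlowup η I →
      ∃ (J : V.IdealSheafData) (V' : Scheme.{0}) (π : V' ⟶ V),
        J ≠ ⊥ ∧ (J.support : Set V) ⊆ η ⁻¹' (I.support : Set U) ∧ IsBlowup π J ∧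
          Scheme.IsRegular V'

/-- On an empty scheme every ideal sheaf is the zero one (so `J ≠ ⊥` is unsatisfiable there).
[folklore] -/
theorem idealSheafData_eq_bot_of_isEmpty {V : Scheme.{0}} [IsEmpty V] (J : V.IdealSheafData) :
    J = ⊥ := by
  have h : ∀ I : V.IdealSheafData, I = ⊤ := fun I =>
    (Scheme.IdealSheafData.support_eq_bot_iff I).mp (Closeds.ext (Set.eq_empty_of_isEmpty _))
  rw [h J, h ⊥]

/-- `Spec` of a field is a regular scheme (tree `Scheme.isRegular_Spec`, Mathlib's
`IsRegularRing` instance for fields). [folklore] -/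
theorem isRegular_spec_field (k : Type) [Field k] : Scheme.IsRegular (Spec (.of k)) :=
  Scheme.isRegular_Spec (CommRingCat.of k)

/-- **(S1) the guard `I ≠ ⊥` IS load-bearing in stub 2's predicates: dropped, BOTH are FALSE over
every field** — at `U = Spec k`, `I = ⊥`, the blowing up is `V = ∅` (`isBlowup_bot_of_isEmpty`),
on which no ideal sheaf is `≠ ⊥`. So the junk guard is exactly right (cf. the sibling's
`SandwichedBlowupNeBot` analysis for `PatchingRel`). [folklore] -/
theorem not_singAdmissibleNoNeBotAt (k : Type) [Field k] : ¬ SingAdmissibleNoNeBotAt k := by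
  intro h
  obtain ⟨J, V', π, hJ, -, -, -⟩ := h (Spec (.of k)) ∅ (𝟙 _) (Scheme.emptyTo _) ⊥
    inferInstance inferInstance inferInstance inferInstance (isRegular_spec_field k)
    (isBlowup_bot_of_isEmpty _)
  exact hJ (idealSheafData_eq_bot_of_isEmpty J)

/-- (S1) … and the exceptional-admissible one likewise. [folklore] -/
theorem not_excAdmissibleNoNeBotAt (k : Type) [Field k] : ¬ ExcAdmissibleNoNeBotAt k := by
  intro h
  obtain ⟨J, V', π, hJ, -, -, -⟩ := h (Spec (.of k)) ∅ (𝟙 _) (Scheme.emptyTo _) ⊥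
    inferInstance inferInstance inferInstance inferInstance (isRegular_spec_field k)
    (isBlowup_bot_of_isEmpty _)
  exact hJ (idealSheafData_eq_bot_of_isEmpty J)


/-- (S2) the exceptional-admissible predicate with the HYPOTHESIS `Scheme.IsRegular U` DROPPED.
[folklore] -/
def ExcAdmissibleNoRegBaseAt (k : Type) [Field k] : Prop :=
  ∀ (U V : Scheme.{0}) (f : U ⟶ Spec (.of k)) (η : V ⟶ U) (I : U.IdealSheafData),
    IsSeparated f → LocallyOfFiniteType f → QuasiCompact f → IsIntegral U →
    I ≠ ⊥ → IsBlowup η I →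
      ∃ (J : V.IdealSheafData) (V' : Scheme.{0}) (π : V' ⟶ V),
        J ≠ ⊥ ∧ (J.support : Set V) ⊆ η ⁻¹' (I.support : Set U) ∧ IsBlowup π J ∧
          Scheme.IsRegular V'

/-- (S2) the Sing-admissible predicate with the HYPOTHESIS `Scheme.IsRegular U` DROPPED.
[folklore] -/
def SingAdmissibleNoRegBaseAt (k : Type) [Field k] : Prop :=
  ∀ (U V : Scheme.{0}) (f : U ⟶ Spec (.of k)) (η : V ⟶ U) (I : U.IdealSheafData),
    IsSeparated f → LocallyOfFiniteType f → QuasiCompact f → IsIntegral U →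
    I ≠ ⊥ → IsBlowup η I →
      ∃ (J : V.IdealSheafData) (V' : Scheme.{0}) (π : V' ⟶ V),
        J ≠ ⊥ ∧ (∀ x : V, x ∈ J.support → ¬ IsRegularLocalRing (V.presheaf.stalk x)) ∧
          IsBlowup π J ∧ Scheme.IsRegular V'

/-- **Strong resolution of EVERY integral `k`-variety by ONE Sing-supported blowing up** — the
strong blow-up summit slice at `k` (format of every resolution algorithm; cf. the sibling's
`SandwichedBlowupResolution` with `V = X`). [cite: Kollar2007, Thm. 3.36 (format)] -/
def BlowupStrongResAt (k : Type) [Field k] : Prop :=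
  ∀ (V : Scheme.{0}) (g : V ⟶ Spec (.of k)), IsSeparated g → LocallyOfFiniteType g →
    QuasiCompact g → IsIntegral V →
      ∃ (J : V.IdealSheafData) (V' : Scheme.{0}) (π : V' ⟶ V),
        J ≠ ⊥ ∧ (∀ x : V, x ∈ J.support → ¬ IsRegularLocalRing (V.presheaf.stalk x)) ∧
          IsBlowup π J ∧ Scheme.IsRegular V'

/-- **(S2, exceptional side) `Scheme.IsRegular U` is LOAD-BEARING in `ExcAdmissibleAt`: dropped,
the predicate is FALSE over every field of positive characteristic** (the quadric cone with
`I = ⊤`, `η = 𝟙`: `J` must be cosupported in `η⁻¹ V(⊤) = ∅`, so `J = ⊤`, the blowing up is an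
isomorphism and the cone would be regular). Hence stub 2 with `IsRegular U` dropped on both sides
holds VACUOUSLY — a trap, not a simplification. [cite: Matsumura1987, Thm. 14.3] -/
theorem not_excAdmissibleNoRegBaseAt (k : Type) [Field k] (p : ℕ) [Fact p.Prime] [CharP k p] :
    ¬ ExcAdmissibleNoRegBaseAt k := by
  intro h
  have hg : (MvPolynomial.X 0 ^ 2 : MvPolynomial (Fin 1) k) ≠ 0 :=
    pow_ne_zero _ (MvPolynomial.X_ne_zero 0)
  let R : Type := MvPolynomial (Fin 2 ⊕ Fin 1) k ⧸ Ideal.span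
      {(MvPolynomial.X (Sum.inl 0) * MvPolynomial.X (Sum.inl 1) +
        MvPolynomial.rename Sum.inr (MvPolynomial.X 0 ^ 2) : MvPolynomial (Fin 2 ⊕ Fin 1) k)}
  let φ : Spec (.of R) ⟶ Spec (.of k) := Spec.map (CommRingCat.ofHom (algebraMap k R))
  obtain ⟨hsep, hft, hqc, -, -, -⟩ :=
    FRationalResolution.suspension_package k 1 (MvPolynomial.X 0 ^ 2) p hg
  haveI := FRationalResolution.isPrime_span_suspension k 1 (MvPolynomial.X 0 ^ 2) hg
  haveI : IsDomain R := Ideal.Quotient.isDomain _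
  haveI : IsIntegral (Spec (.of R)) := inferInstance
  obtain ⟨J, V', π, -, hJexc, hπ, hreg⟩ := h (Spec (.of R)) (Spec (.of R)) φ (𝟙 _) ⊤ hsep hft hqc
    inferInstance (top_ne_bot_idealSheafData _) (isBlowup_id_top _)
  refine FRationalResolution.suspension_not_isRegular k 1 (MvPolynomial.X 0 ^ 2) p hg
    (Ideal.pow_mem_pow (Ideal.subset_span (Set.mem_range_self 0)) 2)
    (isRegular_of_isBlowup_support_subset_top (fun x hx => ?_) hπ hreg)
  have hx' := hJexc hx
  rw [coe_support_top, Set.preimage_empty] at hx'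
  exact hx'.elim

/-- (S2, exceptional side) … so "stub 2 without `IsRegular U`" holds vacuously at every perfect
field of positive characteristic. [folklore] -/
theorem stub2_noRegBase_vacuous (p : ℕ) (hp : p.Prime) (k : Type) [Field k] [CharP k p] :
    ExcAdmissibleNoRegBaseAt k → SingAdmissibleNoRegBaseAt k := fun h =>
  haveI : Fact p.Prime := ⟨hp⟩
  absurd h (not_excAdmissibleNoRegBaseAt k p)

/-- **(S2, singular side) dropping `Scheme.IsRegular U` from the Sing-admissible predicate gives
EXACTLY strong blow-up resolution of every integral `k`-variety** (→: `U := V`, `I = ⊤`,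
`η = 𝟙`; ←: a blowing up of an integral variety along `I ≠ 0` is an integral variety, tree
`IsBlowup.isIntegral` / `IsBlowup.isProper`). So on the singular side the hypothesis is what keeps
the atom BELOW the strong summit slice; it cannot be dropped for free. [folklore] -/
theorem singAdmissibleNoRegBaseAt_iff_blowupStrongResAt (k : Type) [Field k] :
    SingAdmissibleNoRegBaseAt k ↔ BlowupStrongResAt k := by
  refine ⟨fun h V g hs hl hq hV => ?_, fun h U V f η I hs hl hq hU hI hη => ?_⟩
  · haveI := hV
    exact h V V g (𝟙 V) ⊤ hs hl hq hV (top_ne_bot_idealSheafData V) (isBlowup_id_top V)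
  · haveI := hs; haveI := hl; haveI := hq; haveI := hU
    haveI : IsLocallyNoetherian U := LocallyOfFiniteType.isLocallyNoetherian f
    haveI : IsIntegral V := hη.isIntegral hI
    haveI : IsProper η := hη.isProper
    exact h V (η ≫ f) inferInstance inferInstance inferInstance inferInstance

/-- **Strong blow-up resolution of integral `k`-varieties gives the crux's consequent at `k`**
(a blowing up along `J ≠ 0` of an integral variety is proper and birational, tree
`IsBlowup.isProper` / `IsBlowup.isBirational'`; components: tree
`ComponentGluing.hasResolution_of_forall_closeds`). [folklore] -/
theorem resolvesAt_of_blowupStrongResAt {k : Type} [Field k] (h : BlowupStrongResAt k) :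
    ResolvesAt k := by
  intro X f hs hl hq hr
  haveI := hs; haveI := hl; haveI := hq; haveI := hr
  refine ComponentGluing.hasResolution_of_forall_closeds X f fun Z hZ => ?_
  haveI := hZ
  obtain ⟨J, V', π, hJ, -, hπ, hreg⟩ := h _ ((Scheme.IdealSheafData.vanishingIdeal Z).subschemeι ≫ f)
    inferInstance inferInstance inferInstance hZ
  haveI : IsLocallyNoetherian (Scheme.IdealSheafData.vanishingIdeal Z).subscheme :=
    LocallyOfFiniteType.isLocallyNoetherian ((Scheme.IdealSheafData.vanishingIdeal Z).subschemeι ≫ f)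
  haveI : IsProper π := hπ.isProper
  exact ⟨V', π, ⟨inferInstance, hπ.isBirational' hJ, hreg⟩⟩

/-- **(S2, singular side, consequence)** "stub 2's conclusion without `IsRegular U` over every
perfect field" would give weak resolution over EVERY perfect field of positive characteristic —
the antecedent of `DescentPerfectToAll` (stmt-0549), i.e. the summit over perfect fields.
[folklore] -/
theorem resolves_perfect_of_singAdmissibleNoRegBase_perfect
    (h : ∀ p : ℕ, p.Prime → ∀ (k : Type) [Field k] [CharP k p] [PerfectField k],
      SingAdmissibleNoRegBaseAt k) :
    ∀ p : ℕ, p.Prime → ∀ (k : Type) [Field k] [CharP k p] [PerfectField k], ResolvesAt k :=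
  fun p hp k _ _ _ => resolvesAt_of_blowupStrongResAt
    ((singAdmissibleNoRegBaseAt_iff_blowupStrongResAt k).mp (h p hp k))

/-- Conversely the strong blow-up slice gives the atom itself (forget that `U` was regular): the
atom sits BETWEEN "nothing" and the strong blow-up summit slice, the hypothesis `IsRegular U`
being the only thing that makes it weaker than the latter. [folklore] -/
theorem singAdmissibleAt_of_blowupStrongResAt {k : Type} [Field k] (h : BlowupStrongResAt k) :
    SingAdmissibleAt k :=
  fun U V f η I hs hl hq hU _ hI hη =>
    (singAdmissibleNoRegBaseAt_iff_blowupStrongResAt k).mpr h U V f η I hs hl hq hU hI hη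

/-! ### §4.5 The single-blow-up FORMAT of stub 2 is free modulo stub 1 -/

/-- **Strong resolution, format-free, of blowings up of regular `k`-varieties**: a proper
birational `φ : Y → V = Bl_I U` from a regular `Y`, an isomorphism over `Reg V` (the gen-0 atom
SAND⁺ of the sibling crux restricted to `Bl_I U`, at the field `k`).
[cite: CossartPiltant2019, Thm. 1.1 (dimension 3, as printed)] -/
def StrongResRegularBlowupAt (k : Type) [Field k] : Prop :=
  ∀ (U V : Scheme.{0}) (f : U ⟶ Spec (.of k)) (η : V ⟶ U) (I : U.IdealSheafData),
    IsSeparated f → LocallyOfFiniteType f → QuasiCompact f → IsIntegral U → Scheme.IsRegular U →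
    I ≠ ⊥ → IsBlowup η I →
      ∃ (Y : Scheme.{0}) (φ : Y ⟶ V), IsResolution φ ∧
        ∃ W : V.Opens, (W : Set V) = Scheme.regularLocus V ∧ IsIso (φ ∣_ W)

/-- **A Sing-admissible regular blowing up IS a strong resolution** (proper and birational —
tree `IsBlowup.isProper` / `isBirational'` — and an isomorphism over `Reg V`, which misses `V(J)`,
tree `IsBlowup.isIso_morphismRestrict`; the regular locus is open for `V` of finite type over a
field). [cite: GortzWedhorn2020, Prop. 13.91 (3)] -/
theorem strongResRegularBlowupAt_of_singAdmissibleAt {k : Type} [Field k] (h : SingAdmissibleAt k) :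
    StrongResRegularBlowupAt k := by
  intro U V f η I hf₁ hf₂ hf₃ hU hUreg hI hη
  haveI := hf₁; haveI := hf₂; haveI := hf₃; haveI := hU
  haveI : IsLocallyNoetherian U := LocallyOfFiniteType.isLocallyNoetherian f
  haveI : IsIntegral V := hη.isIntegral hI
  haveI : IsProper η := hη.isProper
  haveI : LocallyOfFiniteType (η ≫ f) := inferInstance
  haveI : IsLocallyNoetherian V := LocallyOfFiniteType.isLocallyNoetherian (η ≫ f)
  obtain ⟨J, V', π, hJ, hJsing, hπ, hreg⟩ := h U V f η I hf₁ hf₂ hf₃ hU hUreg hI hη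
  haveI : IsProper π := hπ.isProper
  let W : V.Opens :=
    ⟨Scheme.regularLocus V, isOpen_regularLocus_of_locallyOfFiniteType_field (η ≫ f)⟩
  have hdisj : Disjoint (W : Set V) (J.support : Set V) :=
    Set.disjoint_left.mpr fun x hxW hxJ => hJsing x hxJ hxW
  exact ⟨V', π, ⟨inferInstance, hπ.isBirational' hJ, hreg⟩, W, rfl, hπ.isIso_morphismRestrict hdisj⟩

/-- **FORMAT UPGRADE at one field: stub 1 + format-free strong resolution of `Bl_I U` ⇒ stub 2's
conclusion** (Raynaud–Gruson `Reg V`-admissible domination, Stacks 081T, + Axiom 4 on the regular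
`Y` + Stacks 080A backwards + Temkin 2.1.4; the tree's generic
`exists_isBlowup_supported_isRegular_of_isIso_over`). So, MODULO STUB 1 — which the line assumes
anyway — the single-blow-up / Sing-cosupport format of `SingAdmissibleAt` costs nothing: stub 2 is
"exceptional-admissible ⇒ STRONG resolution of `Bl_I U`", format-free.
[cite: StacksProject, Tag 081T] [cite: Temkin2008, Lemma 2.1.4] -/
theorem singAdmissibleAt_of_principalizationAt_of_strongRes {k : Type} [Field k]
    (hA : PrincipalizationAt k) (hS : StrongResRegularBlowupAt k) : SingAdmissibleAt k := by
  intro U V f η I hf₁ hf₂ hf₃ hU hUreg hI hη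
  haveI := hf₁; haveI := hf₂; haveI := hf₃; haveI := hU
  haveI : IsLocallyNoetherian U := LocallyOfFiniteType.isLocallyNoetherian f
  haveI : IsIntegral V := hη.isIntegral hI
  haveI : IsProper η := hη.isProper
  let g : V ⟶ Spec (.of k) := η ≫ f
  haveI : IsLocallyNoetherian V := LocallyOfFiniteType.isLocallyNoetherian g
  haveI : CompactSpace V := QuasiCompact.compactSpace_of_compactSpace g
  haveI : IsNoetherian V := {}
  obtain ⟨Y, φ, hres, W, hW, hiso⟩ := hS U V f η I hf₁ hf₂ hf₃ hU hUreg hI hη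
  haveI := hres.isProper
  haveI := hiso
  haveI : IsIntegral Y := by
    haveI := hres.isRegular.isReduced
    exact hres.isBirational.isIntegral
  have hgenW : genericPoint V ∈ W := by
    show genericPoint V ∈ (W : Set V)
    rw [hW]
    apply Scheme.genericPoints_subset_regularLocus
    rw [genericPoints_eq_singleton]
    rfl
  have hA4 : ∀ I' : Y.IdealSheafData, I' ≠ ⊥ →
      ∃ (Q : Y.IdealSheafData) (Y₁ : Scheme.{0}) (σ : Y₁ ⟶ Y),
        (Q.support : Set Y) ⊆ I'.support ∧ IsBlowup σ Q ∧ Scheme.IsRegular Y₁ ∧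
          IsEffectiveCartier (I'.comap σ) := fun I' hI' =>
    hA Y (φ ≫ g) inferInstance inferInstance inferInstance inferInstance hres.isRegular I' hI'
  obtain ⟨Q', V'', ρ, hQ', hQ'T, hρ, hreg''⟩ :=
    exists_isBlowup_supported_isRegular_of_isIso_over φ W hgenW hA4
  refine ⟨Q', V'', ρ, hQ', fun x hx hxreg => ?_, hρ, hreg''⟩
  have : x ∈ (W : Set V) := by rw [hW]; exact hxreg
  exact hQ'T hx this

/-- **Hence the residual of `birth` at `k`, format-free**: (stub 1 ∧ stub 2) at `k` ⟺ Axiom 4 on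
regular `k`-varieties ∧ strong resolution (any proper birational regular model, isomorphic over
the regular locus) of their blowings up — the per-field form of the tree's
`sandwichedStrongBlowup_iff_strong_and_principalization`. [cite: Piltant2013, §2 Axiom 4 and Prop. 5.1] -/
theorem birthStubsAt_iff_principalization_and_strongRes (k : Type) [Field k] :
    (PrincipalizationAt k ∧ (ExcAdmissibleAt k → SingAdmissibleAt k)) ↔
      (PrincipalizationAt k ∧ StrongResRegularBlowupAt k) :=
  ⟨fun h => ⟨h.1, strongResRegularBlowupAt_of_singAdmissibleAt
      (h.2 (excAdmissibleAt_of_principalizationAt h.1))⟩,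
    fun h => ⟨h.1, fun _ => singAdmissibleAt_of_principalizationAt_of_strongRes h.1 h.2⟩⟩

/-! ### §4.6 Where the residual is known: dimension 3, modulo the vendored Cossart–Piltant facts -/

/-- **The residual `SingAdmissibleAt k` holds for three-dimensional `V = Bl_I U`, over EVERY field,
modulo the two vendored Cossart–Piltant 2019 facts** (`CossartPiltant2019General` = Thm. 1.1 as
printed, strong form; `CossartPiltant2019Principalization` = Prop. 4.4): the tree's fieldwise
`exists_isBlowup_singSupported_isRegular_dim3_of_cossartPiltant`. So the line's open content is
dimension `≥ 4` (dimension `≤ 2`: Lipman / CJS, other vendored facts), exactly as the barrier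
`DimensionFourFrontier` says — perfectness plays no role here either.
[cite: CossartPiltant2019, Thm. 1.1 and Prop. 4.4] -/
theorem singAdmissibleAt_dim3_of_cossartPiltant (hG : CossartPiltant2019General.{0})
    (hP : CossartPiltant2019Principalization.{0}) {k : Type} [Field k] :
    ∀ (U V : Scheme.{0}) (f : U ⟶ Spec (.of k)) (η : V ⟶ U) (I : U.IdealSheafData),
      IsSeparated f → LocallyOfFiniteType f → QuasiCompact f → IsIntegral U → Scheme.IsRegular U →
      I ≠ ⊥ → IsBlowup η I → topologicalKrullDim V = 3 →
        ∃ (J : V.IdealSheafData) (V' : Scheme.{0}) (π : V' ⟶ V),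
          J ≠ ⊥ ∧ (∀ x : V, x ∈ J.support → ¬ IsRegularLocalRing (V.presheaf.stalk x)) ∧
            IsBlowup π J ∧ Scheme.IsRegular V' := by
  intro U V f η I hf₁ hf₂ hf₃ hU _ hI hη hdim
  haveI := hf₁; haveI := hf₂; haveI := hf₃; haveI := hU
  haveI : IsLocallyNoetherian U := LocallyOfFiniteType.isLocallyNoetherian f
  haveI : IsIntegral V := hη.isIntegral hI
  haveI : IsProper η := hη.isProper
  exact exists_isBlowup_singSupported_isRegular_dim3_of_cossartPiltant hG hP V (η ≫ f) hdim

/-! ## §5 Targets — verdicts for the lead (birth line, g2 cycle 1, 2026-08-17)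

* `stub_liu2002` — CLOSED in the tree: `exact Liu2002Thm8124Projective_holds` (`stub_liu2002_holds`);
  the skeleton vet filed the same (check 4 FAIL, `birth_fixed.lean` attached to the item). Not a stub.
* `stub_principalizationPerfect` (`PrincipalizationAt k`, Axiom 4 on regular `U`) — SURVIVES, no
  junk instance: `I = ⊤` ⇒ `Q = ⊤`, `σ = 𝟙` (fine); `I = ⊥` excluded by the guard but junk-TRUE
  anyway (`principalizationAt_bot_instance`: `Q = ⊥`, `U' = ∅`), so the guard is harmless; the two
  conclusion clauses are each half the content (`principalizationNoCartierAt_trivial`,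
  `principalizationNoRegSourceAt_holds`); the hypothesis `IsRegular U` is load-bearing
  (`not_principalizationNoRegBaseAt`, quadric cone). Fieldwise it IS exceptional-admissible
  desingularization (`principalizationAt_iff_excAdmissibleAt`). PRINT CHECK (Piltant 2013 = RACSAM
  107, read pp. 4–5 of the held text): Axiom 4 is stated for NORMAL PROJECTIVE models `X` with all
  three conclusions relative to `Reg X` ((i) `I𝒪` principal over `π⁻¹ Reg X`, (ii) `π⁻¹ Reg X ⊆ Reg X̃`,
  (iii) iso over `Reg X ∩ {I principal}`); the stub is the `U := Reg X` reading with (iii) WEAKENED to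
  `V(Q) ⊆ V(I)` (a centre inside a principal hypersurface `V(I)` is allowed) and (ii) STRENGTHENED to
  `X̃` regular everywhere — over a regular `U` the two readings agree. Such `U = Reg X` are
  quasi-projective: see SLACK.
* `stub_badPointsPerfect` (`ExcAdmissibleAt k → SingAdmissibleAt k`) — SURVIVES: an implication
  between two open, believed statements at every `k` (both ⟸ strong resolution by Sing-admissible
  blow-up towers, Stacks 080L; both known for `dim ≤ 3`). Junk: `I ≠ ⊥` is load-bearing and right
  (`not_singAdmissibleNoNeBotAt`, `not_excAdmissibleNoNeBotAt`: at `I = ⊥` the blowing up is `∅`);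
  `IsRegular U` is load-bearing ASYMMETRICALLY — dropped on the exceptional side the antecedent is
  FALSE (`not_excAdmissibleNoRegBaseAt`, cone with `I = ⊤`) so the mutated stub is a vacuous trap
  (`stub2_noRegBase_vacuous`); dropped on the singular side the consequent becomes strong blow-up
  resolution of ALL varieties (`singAdmissibleNoRegBaseAt_iff_blowupStrongResAt`), which implies the
  crux's consequent at `k` (`resolvesAt_of_blowupStrongResAt`) — summit-strength. PRINT CHECK: Piltant's
  bad points (Def. 5.4, p. 25 of the held text) are points `x ∈ Reg X₁` with `dim 𝒪_{X₁,x} = 2` whose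
  closure lies in the fundamental locus of `η⁻¹` and meets `Sing X₁` — a dimension-3 device (curves
  and finitely many closed points); nothing in print above dimension 3, as the card says.
* JOINT SUFFICIENCY — kernel-checked in the skeleton (`PatchingPerfect_of`) and re-derived here
  WITHOUT stub 3 (`patchingPerfect_of_two_stubs`). EXACT RESIDUAL: `stub 1 ∧ stub 2 ↔ ∀ p k perfect,
  SingAdmissibleAt k` (`stubs_iff_singAdmissible_perfect`) — the per-field slice of the sibling crux
  `PatchingRel`'s atom SAND⁺ᵇ on `Bl_I U`, whose line `sandwiched-gluing` was declared line-dead after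
  five lead seats (`Cruxes/PatchingRel/LINE-STATUS.md`); `PerfectField k` is consumed by no step.
* SLACK #1 (reshape hint, not a defect): the pipeline evaluates the atom only at `U = Reg Y`, `Y` a
  projective model — QUASI-PROJECTIVE — and `patchingPerfect_of_singAdmissibleQProj_perfect` proves
  the crux from the quasi-projective atom `SingAdmissibleQProjAt` over perfect fields alone (the
  sibling's v3.8 cut `stub_sandwichedBlowupResolutionQProj`; tree conjecture
  `RegularBlowupSingAdmissibleResolutionQProj`). Both open stubs may be restricted to quasi-projective
  regular `U` at no cost; this is also the print-faithful scope (Axiom 4 / Prop. 5.1 are about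
  projective models).
* FORMAT (§4.5): modulo stub 1 the single-blow-up / Sing-cosupport format of stub 2 is FREE —
  `birthStubsAt_iff_principalization_and_strongRes : (stub 1 ∧ stub 2) at k ↔ PrincipalizationAt k ∧
  StrongResRegularBlowupAt k` (any proper birational regular model of `Bl_I U` isomorphic over its
  regular locus; Raynaud–Gruson domination + Axiom 4 + Temkin 2.1.4, tree
  `exists_isBlowup_supported_isRegular_of_isIso_over`). So the line's second open piece is exactly
  classical STRONG RESOLUTION OF SANDWICHED SINGULARITIES over the perfect field `k`, no format tax.
* SLACK #2 (honest, by design): the residual `SingAdmissibleAt k` is a STRONG-resolution statement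
  (isomorphism over `Reg V`, blow-up format) and is not implied by the crux's weak consequent
  `ResolvesAt k`; conversely it gives `ResolvesAt k` only together with `RelLUAt k` (the resolving
  system). So a kill of stub 2 would NOT refute the crux (`not_patchingPerfect_iff` still needs LU
  proved and weak resolution refuted), and a proof of the crux by this line proves more than the crux.
* KNOWN RANGE (§4.6): the residual holds for `dim V = 3` over every field modulo the vendored
  `CossartPiltant2019General` + `CossartPiltant2019Principalization`
  (`singAdmissibleAt_dim3_of_cossartPiltant`, tree, fieldwise) — open content = dimension ≥ 4.
* LANDED (g2): `Theorems/PatchingPerfect/Negative/BirthResidual.lean` (p162713, ACCEPTED),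
  `…/BirthLoadBearing.lean` (p162831, ACCEPTED), `…/BirthFormat.lean` (p163016, ACCEPTED) — statements
  inlined, importable by ideators / planners / the lead.
* No `stuck_stubs` / `targets` in the payload (lead_cycles = 0). Literature this cycle: searchd /
  OpenAlex / S2 all degraded (rc 75 / HTTP 429) — no new search verdicts; Piltant 2013 read locally.
-/

end Summit.ResolutionOfSingularities.ResolutionOfSingularities.Cruxes.PatchingPerfect.Disproof

end
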